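import Literature.MathematicalPhysics.QuantumFieldTheory.Balaban1983to89.B6GradLegKLevelV1
import Literature.MathematicalPhysics.QuantumFieldTheory.Balaban1983to89.B6Ineq2133GDivLapTwoScaleV1

/-!
# `Balaban1983to89.B6LapLegKLevelV1` — T. Bałaban, *Propagators and renormalization transformations for lattice gauge theories. II*,
# Commun. Math. Phys. **96** (1984) 223–250 [Balaban1984PropagatorsII], Prop. 2.6 p. 247, THE FIRST LEG `Δ(h_□G_□h_□)` OF (2.141) FOR THE ENTRY
# `|(ΔGJ)(x)| ≤ O(1)·1·e^{−δ₃d(y,y′)}|J|` OF (2.136), FOR THE GENUINE MEMBER `G_□` OF A CUBE ON THE `k`-LEVEL V1 TORUS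

statement-level skeleton of published theorems with citation tags; proofs where landed; nothing here is a claim about the Yang–Mills mass gap

PDF held: `paper:balaban1984-cmp96-propagators-rt-ii` (journal page = PDF page + 222), p. 247 [PDF 25] re-read this generation on the ×2 render
`b2b-balaban-ref1/pages/1984-cmp96-propagators-rt-II/…-p025-x2.png`: *"|(G_□J)(x)|, |(∇G_□J)(x)| ≤ O(1)[(Lʲη)², Lʲη]e^{−δ₂(Lʲη)^{−1}dist(Δ,Δ′)}|J|
(2.133)"*; *"Proposition 2.6. … |(GJ)(x)|, |(∇GJ)(x)|, |(G∇*J)(x)|, |(ΔGJ)(x)| ≤ O(1)[(Lʲη)², Lʲη, Lʲη, 1]e^{−δ₃d(y,y′)}|J| (2.136) for x ∈ Δ(y), y ∈ Λ_j,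
supp J ⊂ Δ(y′), with the constant O(1) depending on d and L only"*; *"G = G₀(I − R)⁻¹ = Σ_n G₀Rⁿ = Σ_ω h_{□₀}G_{□₀}h_{□₀}·K_{□₁,□₂}G_{□₂}h_{□₂}·…
(2.141) and the series above is convergent in the norms appearing in the inequalities (2.136)–(2.140)"*; p. 239 [PDF 17] (2.92) line 1:
*"Σ_{b∈st(x)}(∂h_□)(b)(∂A_μ)(b) − (Δh_□)(x)A_μ(x)"*; p. 246 [PDF 24] Prop. 2.5: *"The operator G_□ … satisfies all the inequalities (1.110)–(1.114) of the
Proposition 1.2"* ([4] = [Balaban1984PropagatorsI], (1.110) p. 35 lists `|ΔGJ|` with the prefactor `1`).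

CITATION HEADER (lean-in-tree rule) — WHAT IS REPRODUCED.  Phase-2 file of the `lit-balaban` typed skeleton (HOME `run/shared/lean/pub/lit-balaban/`),
seat **p38 gen 31** (free target under protocol G.5-34(d), TAKING line HOME/STATUS.md 2026-08-23T16:53:34Z, cc the B6 fold owner r03, p22, r05);
SKELETON rows **B6.Prop2.6** × B6.Eq2.133 × B6.Eq2.141 × B6.Eq2.92 (cells only; decls of record untouched).
THE MATHEMATICS (print's *"reasoning in the same way as in the proof of Proposition 2.2"* for the FOURTH column of the table (2.136)): the first leg of the
walk (2.141) for `ΔG`, `Δ = Σ_ν ∇*_ν∇_ν` the componentwise lattice Laplacian, is, by the lattice Leibniz rule (print's (2.92) line 1 read twice),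
`Δ(h_□G_□h_□) = h_□·(ΔG_□)·h_□ − Σ_ν[(∇_νh_□)·(∇_νG_□)·h_□ + (∇*_νh_□)·(∇*_νG_□)·h_□] + (Δh_□)·G_□·h_□`;
the first term is (2.133)₄ = (1.110)₄ for the member (`O(1)·1`), the middle ones are `|∇h_□| ≤ O(1)(MLʲη)⁻¹` times (2.133)₂ (`O(1)Lʲη`), the last is
`|Δh_□| ≤ O(1)(MLʲη)⁻²` times (2.133)₁ (`O(1)(Lʲη)²`) — together `O(1)·1·e^{−δd_T}`: the prefactor `1` of (2.136)₄.  THIS FILE, on r03's cube members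
(`…B6CubeWindowV1.Gl`, the skeleton's `h_□ = hB`, p38's legs `E_e = EC` of `…B6Eq292MemberTorusV1`), in the format of the sibling `…B6GradLegKLevelV1` (gen 30):
* §1 (any V1 torus `P`): `shBi ν` (`(S_ν⁻¹f)(b) = f(b − e_ν)`), **`DVa ν c′ := c′•(S_ν⁻¹ − 1)`** (the backward difference = the `ℓ²`-adjoint `∇^η*_ν` up to
  sign), **`LapV c′ := Σ_ν DVa ν c′ * DV ν c′`** — `(LapV f)(b) = c′²Σ_ν(2f(b) − f(b − e_ν) − f(b + e_ν))` (`LapV_apply`), the componentwise lattice Laplacian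
  (sign convention of the tree's `TSIdx.lapTS = Σ_λ∇_λ*∇_λ`, print's `−Δ`; all bounds are on absolute values); the LEIBNIZ RULE **`LapV_mul_mulOp`**
  `LapV·(h·) = (h·)·LapV − Σ_ν[((∇_νh)·)·DV_ν + ((∇*_νh)·)·DVa_ν] + ((Δh)·)` (= p22's member identity `…B6Eq292MemberTwoScaleV1.leibniz_lapTS` read on the
  global torus); translations commute (`TB_mul_shBi/DVa/LapV`);
* §2 (a two-scale member `t` with its full bond window chart, r03's `…B6AgreeLapV1Chart`): `transplant_Dla_apply_deep`, **`transplant_lapTS_apply_deep`**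
  (on a `1`-deep bond the transplant of the member's `Δ = Σ∇*∇` IS `L^{2j}·Σ_ν(2f(b) − f(b−e_ν) − f(b+e_ν))`: `eS_shift`/`eS_unshift`),
  `mulOp_mul_transplant_Dla` (`χ·ε∇*_νρ = (Lʲ/c′)•χ·DVa`), **`mulOp_mul_transplant_lapTS`** (`χ·εΔρ = (Lʲ/c′)²•χ·LapV`) for `χ` supported on `1`-deep bonds;
* §3 (the cube `□`): `EC_false`/`mulOp_mul_EC_false` (`χ·E_(ν,−) = (L^{j₀}/c′)•χ·DVa`), the def with body **`LC`** (`= τ_{−v}(εΔ_memberρ)τ_v`, the Laplacian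
  companion of p38's `EC`), `LC_mul_Gl_eq` (`LC·G_□ = τ_{−v}(s(□)⁻¹•ε(ΔG_□)ρ)τ_v`, as r03's `EC_mul_Gl_eq`), **`mulOp_mul_LC`** (`χ·LC = (L^{j₀}/c′)²•χ·LapV`),
  **`hLapGin_cube`** (the member input (2.133)₄: `InMajorant (geomT D) (blkV1 hN D) (LC·G_□) (Q^T_□) (C·(L^{j(y)}/c′)²·e^{−δ_G d_T})` from p22's
  `…B6Ineq2133GDivLapTwoScaleV1.ineq2133_LapG` ((1.110)₄ for the member) through r03's band bridge `inDecay_window_V1` EXACTLY as `hEGin_cube`), the supports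
  and sizes of `S_ν⁻¹h_□`, `∇*_νh_□`, `Δh_□` (`abs_LapV_hB_le`: `|Δh_□| ≤ c′²(d+1)·C2F/(8S/5)²`, p38's `abs_hT_second_diff_le`), the depth of `h_□`, `∇h_□`,
  `∇*h_□` in the window, and the operator identity **`LapV_sandwich_eq`**;
* §4 **`hLapG0_cube`** — THE FIRST LEG OF (2.141) FOR `ΔG` PER CUBE: there are `ρ_Δ > 0`, `C_Δ ≥ 0` (on `d, L` and the weight band only) such that on every
  admissible torus (`M_h = Lᵃ ≥ 8`, `R ≥ 2L²`, `P′ ≥ 5`, `L ≥ 5`, cube placed), for every `c′ ≠ 0`, weights `w` and cube `□`: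
  `HasMajorant (geomT D) (blkV1 hN D) (LapV c′ * (h_□·G_□·h_□)) (1_{□⁺}(y)·C_Δ·e^{−ρ_Δ d_T(y,y′)})` — print's `O(1)·1·e^{−δd}` for the first leg.
Defs with bodies: `shBi`, `DVa`, `LapV` (§1), `LC` (§3).  No `def … : Prop`, no new hypothesis; standard axioms.

HONEST SCOPE / DIVERGENCES.  (1) `LapV` carries the tree's sign (`Σ∇*∇ ≥ 0`), print's `Δ` the opposite; (2.136)₄ is a bound on `|ΔGJ|`, insensitive to the
sign.  (2) The constant `C_Δ` carries `L⁴` (levels of `□⁺` are `≤ j₀ + 2`); print: *"O(1) depending on d and L only"*; the `M⁻¹`, `M⁻²` of the `∇h_□`, `Δh_□`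
terms are not kept (not needed).  (3) Hypotheses as r03's member inputs (`L ≥ 5` from the band lemma, `M_h = Lᵃ ≥ 8`, `R ≥ 2L²`, `P′ ≥ 5`, placed cube).
(4) This is ONE leg; the (2.136)₄ theorem for the genuine k-level `G` is the sibling `…B6Prop26LapKLevelV1` (this seat), through p38 g30's universal
left-factor clause `…B6Prop26PairKLevelAssemblyV1.prop26_pair_kLevel_assembly_le`.  (5) The THIRD entry `|(G∇*J)(x)|` of (2.136) is NOT of left-factor
form and is not treated here (it needs the transposed walk; see HOME/GAPS.md).  Integer torus, lattice units; nothing on d = 4 specifically or the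
continuum; NOT summit progress.  Unit `lit-balaban-p38` (gen 31), 2026-08-23.
-/

noncomputable section

open scoped BigOperators
open Finset

namespace Literature.MathematicalPhysics.QuantumFieldTheory.Balaban1983to89.B6LapLegKLevelV1

open LatticeFieldCalculus
open B4Reflection242 (boxDom)
open B4TorusKernel.MultiPeriod (torusSupNorm)
open B6MultiLevelBoxOperator (N0 bigSide)
open B6MultiLevelTorusOperator (TDomains tshift unitVec one_le_of_mem)
open B6Cover236MultiLevelBlocks (cubes)
open B6Geom246MultiLevelBox (bset blkOf)
open B6Geom246MultiLevelTorus (geomT torusSupNorm_neg)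
open B8Ineq192MultiLevelTorus (geomT_len)
open B6Eq238MultiLevelTorus (svec)
open B6RandomWalk (HasMajorant hasMajorant_mono hasMajorant_add BlockSupp)
open B6Prop26Gluing (mulOp mulOp_apply ind ind_nonneg ind_le_one ind_of_mem ind_of_not_mem hasMajorant_finsetSum)
open B6Ineq2133TwoScaleV1 (onFun onFun_apply)
open B6Prop26ReachTransplant (transplant restrictOp extendOp transplant_apply restrictOp_apply_of_injOn extendOp_apply transplant_mul_of_bij)
open B6GlobalChartV1 (PV toBox blkV1 domT)
open B6AgreeLapV1Chart (cB eB eS DeepS mem_cB_W eS_shift eS_unshift deepS_mono shift_mem_deepS unshift_mem_deepS onFun_comp)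
open B6Prop25TwoScaleCensus (TSIdx)
open B6SectAOperatorsV1 (BondIdx)
open B6TranslateV1 (trV trV_apply)
open B6TranslateTorusV1 (vch TB TB_apply TB_mul_TB_neg TB_neg_mul_TB TB_mul_mulOp mulOp_eq_conj toBox_add_tv kernel_blkMap)
open B6ScalarChartV1 (toBox_shift toBox_unshift)
open B6Partition118KLevelFineSizes (C1F C1F_nonneg)
open B6Partition118KLevelFineSecond (C2F C2F_nonneg)
open B6Partition118KLevelTorus (hT)
open B6Partition118KLevelTorusCentral (QT one_le_of_four_le blkOf_mem_QT_of_hT_ne_zero)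
open B6Partition118KLevelTorusBinders (abs_hT_sub_le_near abs_hT_second_diff_le)
open B6Prop26KLevelSkeletonV1 (hB hB_apply ST mem_ST pref pref_nonneg abs_hB_le_one blkV1_mem_QT_of_hB_ne_zero)
open B6InMajorantTransplant (InMajorant inMajorant_mono inMajorant_conj_chart inMajorant_congr_set)
open B6InDecayWindowV1 (inDecay_window_V1 inMajorant_smul_of_le_on)
open B6CubeWindowV1 (tC tC_j sc sc_inv x0 hx0 hfit wC hch hch_deep Placed j0 j0_le_level Gl trV_hB SQ mem_blkMap_image_SQ one_le_of_eight_le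
  four_le_of_five_le)
open B6Eq292MemberTorusV1 (EC)
open B6CubeInDecayV1 (hGin_cube hEGin_cube hdiv_cube hlev_full hband_cube sc_inv_le_pref transplant_off conj_mul Gl_eq sc_nonneg smul_kernel_le)
open B6CubeCoeffSizesV1 (blkOf_mem_QT_of_near_hT torusSupNorm_tshift_unitVec_le level_le_of_mem_QT one_le_ell)
open B6Prop26LeftEntryKLevelV1 (hasMajorant_sandwich_in)
open B6Prop26KLevelAssemblyV1 (hasMajorant_smul)
open B6Ineq2133GDivLapTwoScaleV1 (ineq2133_LapG)
open B6GradLegKLevelV1 (shB shB_apply DV DV_apply DV_mul_mulOp TB_mul_shB TB_mul_DV trV_shB abs_DV_apply transplant_Dl_apply_deep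
  mulOp_mul_transplant_Dl EC_true mulOp_mul_EC_true blkV1_mem_ST_of_hB_shift_ne_zero abs_hB_shift_sub_le shB_hB_deep pref_scale_le lip_scale_le)
open B10StarCount (shift_unshift unshift_shift)

/-! ## §1  The backward difference `∇^η*_ν ∼ c′(S_ν⁻¹ − 1)` and the Laplacian `Σ_ν∇*_ν∇_ν` on fine bond functions of a V1 torus; the Leibniz rule -/

section Diff

variable {P : Params}

/-- **THE BACKWARD SHIFT `(S_ν⁻¹f)(b) = f(b − e_ν)`** of fine bond functions (same direction, initial point moved by `−e_ν`).
[cite: Balaban1984PropagatorsI, (1.4) p.18 («∇^η_μ», its adjoint), dictionary] -/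
def shBi (ν : Fin P.d) : Module.End ℝ (PBond P 0 → ℝ) where
  toFun f := fun b => f ⟨b.src.unshift ν, b.dir⟩
  map_add' f f' := by funext b; rfl
  map_smul' r f := by funext b; rfl

/-- `S_ν⁻¹` evaluated. [cite: Balaban1984PropagatorsI, (1.4) p.18, dictionary] -/
@[simp] theorem shBi_apply (ν : Fin P.d) (f : PBond P 0 → ℝ) (b : PBond P 0) : shBi ν f b = f ⟨b.src.unshift ν, b.dir⟩ := rfl

/-- **THE BACKWARD DIFFERENCE `c′·(S_ν⁻¹ − 1)`** on fine bond functions (the `ℓ²`-adjoint of `∇^η_ν = c′(S_ν − 1)` is `c′(S_ν⁻¹ − 1) = ∇^η*_ν`; the member's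
`TSIdx.Dla`). [cite: Balaban1984PropagatorsI, (1.4) p.18, (1.89) p.33 («∇*»); Balaban1984PropagatorsII, Prop. 2.6 (2.136) p.247] -/
def DVa (ν : Fin P.d) (cf : ℝ) : Module.End ℝ (PBond P 0 → ℝ) := cf • (shBi ν - 1)

/-- `(∇*_νf)(b) = c′·(f(b − e_ν) − f(b))`. [cite: Balaban1984PropagatorsI, (1.4) p.18, (1.89) p.33] -/
theorem DVa_apply (ν : Fin P.d) (cf : ℝ) (f : PBond P 0 → ℝ) (b : PBond P 0) :
    DVa ν cf f b = cf * (f ⟨b.src.unshift ν, b.dir⟩ - f b) := by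
  simp [DVa, shBi_apply]

/-- **THE COMPONENTWISE LATTICE LAPLACIAN `Σ_ν ∇*_ν∇_ν`** of fine bond functions with the fine factor `c′ = η⁻¹` (the `Δ` of `|(ΔGJ)(x)|` in (2.136), in
the sign convention of the tree's `TSIdx.lapTS`). [cite: Balaban1984PropagatorsII, Prop. 2.6 (2.136) p.247 («|(ΔGJ)(x)|»); Balaban1984PropagatorsI, (1.110) p.35] -/
def LapV (cf : ℝ) : Module.End ℝ (PBond P 0 → ℝ) := ∑ ν : Fin P.d, DVa ν cf * DV ν cf

/-- **`(Δf)(b) = c′²·Σ_ν(2f(b) − f(b − e_ν) − f(b + e_ν))`**. [cite: Balaban1984PropagatorsI, (1.21) p.21, (1.110) p.35; Balaban1984PropagatorsII, (2.136) p.247] -/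
theorem LapV_apply (cf : ℝ) (f : PBond P 0 → ℝ) (b : PBond P 0) :
    LapV cf f b = cf ^ 2 * ∑ ν : Fin P.d, (2 * f b - f ⟨b.src.unshift ν, b.dir⟩ - f ⟨b.src.shift ν, b.dir⟩) := by
  unfold LapV
  rw [LinearMap.sum_apply, Finset.sum_apply, Finset.mul_sum]
  refine Finset.sum_congr rfl fun ν _ => ?_
  rw [Module.End.mul_apply, DVa_apply, DV_apply, DV_apply]
  simp only [shift_unshift]
  ring

/-- `|Δf(b)| ≤ c′²·Σ_ν|2f(b) − f(b − e_ν) − f(b + e_ν)|`. [cite: Balaban1984PropagatorsI, (1.110) p.35, bookkeeping] -/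
theorem abs_LapV_apply_le (cf : ℝ) (f : PBond P 0 → ℝ) (b : PBond P 0) :
    |LapV cf f b| ≤ cf ^ 2 * ∑ ν : Fin P.d, |2 * f b - f ⟨b.src.unshift ν, b.dir⟩ - f ⟨b.src.shift ν, b.dir⟩| := by
  rw [LapV_apply, abs_mul, abs_of_nonneg (sq_nonneg cf)]
  exact mul_le_mul_of_nonneg_left (Finset.abs_sum_le_sum_abs _ _) (sq_nonneg cf)

/-- `|∇*_νf(b)| = |c′|·|f(b − e_ν) − f(b)|`. [cite: Balaban1984PropagatorsI, (1.4) p.18, bookkeeping] -/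
theorem abs_DVa_apply (ν : Fin P.d) (cf : ℝ) (f : PBond P 0 → ℝ) (b : PBond P 0) :
    |DVa ν cf f b| = |cf| * |f ⟨b.src.unshift ν, b.dir⟩ - f b| := by
  rw [DVa_apply, abs_mul]

/-- **THE LATTICE LEIBNIZ RULE FOR THE LAPLACIAN** as an operator identity:
`Δ·(h·) = (h·)·Δ − Σ_ν[((∇_νh)·)·∇_ν + ((∇*_νh)·)·∇*_ν] + ((Δh)·)` (p22's member identity `leibniz_lapTS`, read on the global torus; print's (2.92) line 1
*"Σ_{b∈st(x)}(∂h_□)(b)(∂A_μ)(b) − (Δh_□)(x)A_μ(x)"*). [cite: Balaban1984PropagatorsII, (2.92) p.239 (line 1), (2.141) p.247] -/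
theorem LapV_mul_mulOp (cf : ℝ) (h : PBond P 0 → ℝ) :
    LapV cf * mulOp h = mulOp h * LapV cf - ∑ ν : Fin P.d, (mulOp (DV ν cf h) * DV ν cf + mulOp (DVa ν cf h) * DVa ν cf) + mulOp (LapV cf h) := by
  apply LinearMap.ext; intro f; funext b
  simp only [Module.End.mul_apply, LinearMap.add_apply, LinearMap.sub_apply, Pi.add_apply, Pi.sub_apply, mulOp_apply, LapV_apply,
    LinearMap.sum_apply, Finset.sum_apply, DV_apply, DVa_apply, Finset.mul_sum, Finset.sum_mul, ← Finset.sum_sub_distrib, ← Finset.sum_add_distrib]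
  refine Finset.sum_congr rfl fun ν _ => ?_
  ring

/-- the torus translation commutes with `S_ν⁻¹`. [cite: Balaban1984PropagatorsII, (2.19) p.226, dictionary] -/
theorem TB_mul_shBi (a : Site P 0) (ν : Fin P.d) : TB a * shBi ν = shBi ν * TB a := by
  apply LinearMap.ext; intro f; funext b
  simp only [Module.End.mul_apply, TB_apply, shBi_apply, PBond.translate, B6TranslateV1.unshift_add]

/-- the torus translation commutes with `∇*_ν`. [cite: Balaban1984PropagatorsII, (2.19) p.226, dictionary] -/
theorem TB_mul_DVa (a : Site P 0) (ν : Fin P.d) (cf : ℝ) : TB a * DVa ν cf = DVa ν cf * TB a := by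
  rw [DVa, mul_smul_comm, smul_mul_assoc, mul_sub, sub_mul, TB_mul_shBi, mul_one, one_mul]

/-- the torus translation commutes with `Δ`. [cite: Balaban1984PropagatorsII, (2.19) p.226, dictionary] -/
theorem TB_mul_LapV (a : Site P 0) (cf : ℝ) : TB a * LapV cf = LapV cf * TB a := by
  unfold LapV
  rw [Finset.mul_sum, Finset.sum_mul]
  refine Finset.sum_congr rfl fun ν _ => ?_
  rw [← mul_assoc, TB_mul_DVa, mul_assoc, TB_mul_DV, mul_assoc]

/-- `τ_a(S_ν⁻¹h) = S_ν⁻¹(τ_ah)` for bond functions. [cite: Balaban1984PropagatorsII, (2.19) p.226, dictionary] -/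
theorem trV_shBi (a : Site P 0) (ν : Fin P.d) (h : PBond P 0 → ℝ) : trV a (shBi ν h) = shBi ν (trV a h) := by
  funext b
  simp only [trV_apply, shBi_apply, PBond.translate, B6TranslateV1.unshift_add]

end Diff

/-! ## §2  The member's `∇*_ν = Lʲ(S_ν⁻¹ − 1)` and `Δ = Σ∇*_ν∇_ν` transplanted through the full bond window, on `1`-deep bonds -/

section Member

variable {d ℓ : ℕ} {hd : 1 ≤ d + 1} {hL : Odd (ℓ + 1) ∧ 1 < ℓ + 1} {a₀ a₁ : ℝ} {m K : ℕ}
variable (t : TSIdx d (ℓ + 1) hd hL a₀ a₁) (x₀ : Fin (d + 1) → ℤ)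
variable (hx₀ : ∀ μ, 0 ≤ x₀ μ) (hfit : ∀ μ, x₀ μ + (t.P.sitesPerDir 0 : ℕ) ≤ ((PV d ℓ m K hd hL).sitesPerDir 0 : ℕ))

/-- **THE TRANSPLANTED `∇*_ν` ON A `1`-DEEP BOND**: `(ε∇*_νρ f)(b) = Lʲ·(f(b − e_ν) − f(b))` when `b₋` is `1`-deep in the window (no wrap: `eS_unshift`).
[cite: Balaban1984PropagatorsII, p.238 (T_□ = □̃³ with periodicity conditions), (2.19) p.226; Balaban1984PropagatorsI, (1.4) p.18, (1.89) p.33] -/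
theorem transplant_Dla_apply_deep (ν : Fin (d + 1)) (f : PBond (PV d ℓ m K hd hL) 0 → ℝ) {b : PBond (PV d ℓ m K hd hL) 0}
    (hb : b.src ∈ DeepS t x₀ 1) :
    transplant (cB t x₀ hx₀ hfit).W (eB t x₀) (onFun (t.Dla ν)) f b =
      ((((ℓ + 1 : ℕ) : ℝ)) ^ t.j) * (f ⟨b.src.unshift ν, b.dir⟩ - f b) := by
  classical
  have hb0 : b.src ∈ DeepS t x₀ 0 := deepS_mono (Nat.zero_le _) hb
  have hbW : b ∈ (cB t x₀ hx₀ hfit).W := mem_cB_W.2 hb0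
  have hb' : (⟨b.src.unshift ν, b.dir⟩ : PBond (PV d ℓ m K hd hL) 0) ∈ (cB t x₀ hx₀ hfit).W :=
    mem_cB_W.2 (unshift_mem_deepS hx₀ (r := 0) hb ν).1
  rw [transplant_apply, if_pos hbW, onFun_apply, TSIdx.Dla_apply]
  have e1 : (⟨(eB t x₀ b).src.unshift ν, (eB t x₀ b).dir⟩ : PBond t.P 0) = eB t x₀ ⟨b.src.unshift ν, b.dir⟩ := by
    show (⟨(eS t x₀ b.src).unshift ν, b.dir⟩ : PBond t.P 0) = ⟨eS t x₀ (b.src.unshift ν), b.dir⟩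
    rw [eS_unshift hx₀ hb ν]
  have hinj := (cB t x₀ hx₀ hfit).inj
  have r1 : (WithLp.toLp 2 (restrictOp (cB t x₀ hx₀ hfit).W (eB t x₀) f) : EuclideanSpace ℝ (PBond t.P 0))
      ⟨(eB t x₀ b).src.unshift ν, (eB t x₀ b).dir⟩ = f ⟨b.src.unshift ν, b.dir⟩ := by
    rw [e1]
    exact restrictOp_apply_of_injOn hinj f hb'
  have r2 : (WithLp.toLp 2 (restrictOp (cB t x₀ hx₀ hfit).W (eB t x₀) f) : EuclideanSpace ℝ (PBond t.P 0)) (eB t x₀ b) = f b :=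
    restrictOp_apply_of_injOn hinj f hbW
  rw [r1, r2]

/-- **THE TRANSPLANTED MEMBER LAPLACIAN ON A `1`-DEEP BOND**: `(εΔρ f)(b) = L^{2j}·Σ_ν(2f(b) − f(b − e_ν) − f(b + e_ν))` when `b₋` is `1`-deep.
[cite: Balaban1984PropagatorsII, p.238 (T_□ = □̃³), (2.19) p.226; Balaban1984PropagatorsI, (1.21) p.21, (1.110) p.35] -/
theorem transplant_lapTS_apply_deep (f : PBond (PV d ℓ m K hd hL) 0 → ℝ) {b : PBond (PV d ℓ m K hd hL) 0} (hb : b.src ∈ DeepS t x₀ 1) :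
    transplant (cB t x₀ hx₀ hfit).W (eB t x₀) (onFun t.lapTS) f b =
      ((((ℓ + 1 : ℕ) : ℝ)) ^ t.j) ^ 2 * ∑ ν : Fin (d + 1), (2 * f b - f ⟨b.src.unshift ν, b.dir⟩ - f ⟨b.src.shift ν, b.dir⟩) := by
  classical
  have hb0 : b.src ∈ DeepS t x₀ 0 := deepS_mono (Nat.zero_le _) hb
  have hbW : b ∈ (cB t x₀ hx₀ hfit).W := mem_cB_W.2 hb0
  have hinj := (cB t x₀ hx₀ hfit).inj
  rw [transplant_apply, if_pos hbW, onFun_apply, TSIdx.lapTS_apply, Finset.mul_sum]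
  refine Finset.sum_congr rfl fun ν _ => ?_
  have hbm : (⟨b.src.unshift ν, b.dir⟩ : PBond (PV d ℓ m K hd hL) 0) ∈ (cB t x₀ hx₀ hfit).W :=
    mem_cB_W.2 (unshift_mem_deepS hx₀ (r := 0) hb ν).1
  have hbp : (⟨b.src.shift ν, b.dir⟩ : PBond (PV d ℓ m K hd hL) 0) ∈ (cB t x₀ hx₀ hfit).W :=
    mem_cB_W.2 (shift_mem_deepS hfit (r := 0) hb ν).1
  have em : (⟨(eB t x₀ b).src.unshift ν, (eB t x₀ b).dir⟩ : PBond t.P 0) = eB t x₀ ⟨b.src.unshift ν, b.dir⟩ := by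
    show (⟨(eS t x₀ b.src).unshift ν, b.dir⟩ : PBond t.P 0) = ⟨eS t x₀ (b.src.unshift ν), b.dir⟩
    rw [eS_unshift hx₀ hb ν]
  have ep : (⟨(eB t x₀ b).src.shift ν, (eB t x₀ b).dir⟩ : PBond t.P 0) = eB t x₀ ⟨b.src.shift ν, b.dir⟩ := by
    show (⟨(eS t x₀ b.src).shift ν, b.dir⟩ : PBond t.P 0) = ⟨eS t x₀ (b.src.shift ν), b.dir⟩
    rw [eS_shift hfit hb ν]
  have r0 : (WithLp.toLp 2 (restrictOp (cB t x₀ hx₀ hfit).W (eB t x₀) f) : EuclideanSpace ℝ (PBond t.P 0)) (eB t x₀ b) = f b :=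
    restrictOp_apply_of_injOn hinj f hbW
  have rm : (WithLp.toLp 2 (restrictOp (cB t x₀ hx₀ hfit).W (eB t x₀) f) : EuclideanSpace ℝ (PBond t.P 0))
      ⟨(eB t x₀ b).src.unshift ν, (eB t x₀ b).dir⟩ = f ⟨b.src.unshift ν, b.dir⟩ := by
    rw [em]; exact restrictOp_apply_of_injOn hinj f hbm
  have rp : (WithLp.toLp 2 (restrictOp (cB t x₀ hx₀ hfit).W (eB t x₀) f) : EuclideanSpace ℝ (PBond t.P 0))
      ⟨(eB t x₀ b).src.shift ν, (eB t x₀ b).dir⟩ = f ⟨b.src.shift ν, b.dir⟩ := by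
    rw [ep]; exact restrictOp_apply_of_injOn hinj f hbp
  rw [r0, rm, rp]

/-- **`χ·ε∇*_νρ = (Lʲ/c′)•χ·DVa`** for every multiplier `χ` supported on `1`-deep bonds (`c′ ≠ 0`).
[cite: Balaban1984PropagatorsII, (2.94) p.239 (rescaling), p.238 (T_□), (2.19) p.226] -/
theorem mulOp_mul_transplant_Dla (ν : Fin (d + 1)) {cf : ℝ} (hcf : cf ≠ 0) (χ : PBond (PV d ℓ m K hd hL) 0 → ℝ)
    (hχ : ∀ b, χ b ≠ 0 → b.src ∈ DeepS t x₀ 1) :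
    mulOp χ * transplant (cB t x₀ hx₀ hfit).W (eB t x₀) (onFun (t.Dla ν)) =
      ((((ℓ + 1 : ℕ) : ℝ)) ^ t.j / cf) • (mulOp χ * DVa ν cf) := by
  apply LinearMap.ext; intro f; funext b
  rw [LinearMap.smul_apply, Pi.smul_apply, smul_eq_mul, Module.End.mul_apply, Module.End.mul_apply, mulOp_apply, mulOp_apply, DVa_apply]
  by_cases hb : χ b = 0
  · rw [hb, zero_mul, zero_mul, mul_zero]
  · rw [transplant_Dla_apply_deep t x₀ hx₀ hfit ν f (hχ b hb)]
    field_simp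

/-- **`χ·εΔρ = (Lʲ/c′)²•χ·LapV`** for every multiplier `χ` supported on `1`-deep bonds (`c′ ≠ 0`).
[cite: Balaban1984PropagatorsII, (2.94) p.239 (rescaling), p.238 (T_□), (2.19) p.226; Balaban1984PropagatorsI, (1.110) p.35] -/
theorem mulOp_mul_transplant_lapTS {cf : ℝ} (hcf : cf ≠ 0) (χ : PBond (PV d ℓ m K hd hL) 0 → ℝ)
    (hχ : ∀ b, χ b ≠ 0 → b.src ∈ DeepS t x₀ 1) :
    mulOp χ * transplant (cB t x₀ hx₀ hfit).W (eB t x₀) (onFun t.lapTS) =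
      ((((ℓ + 1 : ℕ) : ℝ)) ^ t.j / cf) ^ 2 • (mulOp χ * LapV cf) := by
  apply LinearMap.ext; intro f; funext b
  rw [LinearMap.smul_apply, Pi.smul_apply, smul_eq_mul, Module.End.mul_apply, Module.End.mul_apply, mulOp_apply, mulOp_apply, LapV_apply]
  by_cases hb : χ b = 0
  · rw [hb, zero_mul, zero_mul, mul_zero]
  · rw [transplant_lapTS_apply_deep t x₀ hx₀ hfit f (hχ b hb)]
    field_simp

end Member

/-! ## §3  The cube: `E_(ν,−)` against `DVa`, the Laplacian companion `LC` of `EC` against `LapV`, the member input (2.133)₄, supports and sizes -/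

section Cube

variable {d ℓ : ℕ} {hd : 1 ≤ d + 1} {hL : Odd (ℓ + 1) ∧ 1 < ℓ + 1} {a₀ a₁ : ℝ} {m K : ℕ} {Mh k R : ℕ} {P' : Fin (d + 1) → ℕ}
variable (hN : ∀ μ, N0 ℓ Mh k P' μ = (PV d ℓ m K hd hL).sitesPerDir 0) {D : TDomains d ℓ Mh k P' R} (hk : k ≤ m + K)
  (hMh1 : 1 ≤ Mh) (hP4 : ∀ μ, 4 ≤ P' μ) {a : ℕ} (hMha : Mh = (ℓ + 1) ^ a) (c : ↥(cubes D.toDomains)) (ha : a₀ ≤ a₁)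

/-- `E_(ν,−)` of the cube is the conjugated transplant of the member's `∇*_ν`. [cite: Balaban1984PropagatorsII, (2.92) p.239 (line 1), dictionary (charts)] -/
theorem EC_false (hpl : Placed ℓ k P' c.1) (w : BondIdx (domT hN D hk) → ℝ) (cf : ℝ) (ν : Fin (d + 1)) :
    EC hN hk hMh1 hP4 hMha c ha hpl w cf (ν, false) = TB (-vch Mh k (svec ℓ k c.1.1 c.1.2)) *
      transplant (cB (tC hN hk hMh1 hP4 c ha a (wC hN hk c w) cf) (x0 ℓ Mh k c.1) (hx0 hpl) (hfit hN hMh1 hP4 hMha c ha hpl)).W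
        (eB (tC hN hk hMh1 hP4 c ha a (wC hN hk c w) cf) (x0 ℓ Mh k c.1)) (onFun ((tC hN hk hMh1 hP4 c ha a (wC hN hk c w) cf).Dla ν)) *
      TB (vch Mh k (svec ℓ k c.1.1 c.1.2)) := by
  unfold EC
  rw [if_neg Bool.false_ne_true]

include hMha in
/-- **`χ·E_(ν,−) = (L^{j₀}/c′)•χ·DVa ν c′`** for every multiplier `χ` whose chart translate `τ_vχ` is supported on `1`-deep bonds of the window (`c′ ≠ 0`).
[cite: Balaban1984PropagatorsII, (2.92) p.239 (line 1), (2.94) p.239, (2.19) p.226, p.238 (T_□)] -/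
theorem mulOp_mul_EC_false (hpl : Placed ℓ k P' c.1) (w : BondIdx (domT hN D hk) → ℝ) {cf : ℝ} (hcf : cf ≠ 0) (ν : Fin (d + 1))
    (χ : PBond (PV d ℓ m K hd hL) 0 → ℝ)
    (hχ : ∀ b, trV (vch Mh k (svec ℓ k c.1.1 c.1.2)) χ b ≠ 0 →
      b.src ∈ DeepS (tC hN hk hMh1 hP4 c ha a (wC hN hk c w) cf) (x0 ℓ Mh k c.1) 1) :
    mulOp χ * EC hN hk hMh1 hP4 hMha c ha hpl w cf (ν, false) =
      ((((ℓ + 1 : ℕ) : ℝ)) ^ j0 hMh1 hP4 c / cf) • (mulOp χ * DVa ν cf) := by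
  rw [EC_false, mulOp_eq_conj (vch Mh k (svec ℓ k c.1.1 c.1.2)) χ]
  set v := vch (ℓ := ℓ) (m := m) (K := K) (hd := hd) (hL := hL) Mh k (svec ℓ k c.1.1 c.1.2) with hv
  have e1 : TB (-v) * mulOp (trV v χ) * TB v *
      (TB (-v) * transplant (cB (tC hN hk hMh1 hP4 c ha a (wC hN hk c w) cf) (x0 ℓ Mh k c.1) (hx0 hpl) (hfit hN hMh1 hP4 hMha c ha hpl)).W
        (eB (tC hN hk hMh1 hP4 c ha a (wC hN hk c w) cf) (x0 ℓ Mh k c.1)) (onFun ((tC hN hk hMh1 hP4 c ha a (wC hN hk c w) cf).Dla ν)) * TB v) =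
      TB (-v) * (mulOp (trV v χ) * transplant (cB (tC hN hk hMh1 hP4 c ha a (wC hN hk c w) cf) (x0 ℓ Mh k c.1) (hx0 hpl)
        (hfit hN hMh1 hP4 hMha c ha hpl)).W (eB (tC hN hk hMh1 hP4 c ha a (wC hN hk c w) cf) (x0 ℓ Mh k c.1))
        (onFun ((tC hN hk hMh1 hP4 c ha a (wC hN hk c w) cf).Dla ν))) * TB v := by
    simp only [mul_assoc]
    rw [← mul_assoc (TB v) (TB (-v)), TB_mul_TB_neg, one_mul]
  rw [e1, mulOp_mul_transplant_Dla _ _ _ _ ν hcf (trV v χ) hχ, tC_j, mul_smul_comm, smul_mul_assoc]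
  congr 1
  simp only [mul_assoc]
  rw [← TB_mul_DVa]

/-- **THE LAPLACIAN LEG OPERATOR `LC = τ_{−v}(εΔρ)τ_v` OF THE CUBE**: the conjugated transplant of the member's `Δ = Σ_λ∇_λ*∇_λ` (`TSIdx.lapTS`) through
the full bond window — the companion of p38's first-order `EC` for the fourth column of (2.136).
[cite: Balaban1984PropagatorsII, Prop. 2.6 (2.136) p.247 («|(ΔGJ)(x)|»), (2.133) p.247, p.238 (T_□ = □̃³), dictionary (charts)] -/
def LC (hpl : Placed ℓ k P' c.1) (w : BondIdx (domT hN D hk) → ℝ) (cf : ℝ) : Module.End ℝ (PBond (PV d ℓ m K hd hL) 0 → ℝ) :=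
  TB (-vch Mh k (svec ℓ k c.1.1 c.1.2)) *
    transplant (cB (tC hN hk hMh1 hP4 c ha a (wC hN hk c w) cf) (x0 ℓ Mh k c.1) (hx0 hpl) (hfit hN hMh1 hP4 hMha c ha hpl)).W
      (eB (tC hN hk hMh1 hP4 c ha a (wC hN hk c w) cf) (x0 ℓ Mh k c.1)) (onFun (tC hN hk hMh1 hP4 c ha a (wC hN hk c w) cf).lapTS) *
    TB (vch Mh k (svec ℓ k c.1.1 c.1.2))

/-- **`LC·G_□` OF THE CUBE = `τ_{−v}(s(□)⁻¹•ε(ΔG_□)ρ)τ_v`**: the product of the two transplants through the BIJECTIVE window is the transplant of the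
product (as r03's `EC_mul_Gl_eq`). [cite: Balaban1984PropagatorsII, (2.133) p.247, (2.136) p.247, p.238 (T_□ = □̃³), dictionary (charts)] -/
theorem LC_mul_Gl_eq (hpl : Placed ℓ k P' c.1) (w : BondIdx (domT hN D hk) → ℝ) (cf : ℝ) :
    LC hN hk hMh1 hP4 hMha c ha hpl w cf * Gl hN hk hMh1 hP4 hMha c ha hpl w cf = TB (-vch Mh k (svec ℓ k c.1.1 c.1.2)) *
      ((sc hMh1 hP4 c cf)⁻¹ • transplant (cB (tC hN hk hMh1 hP4 c ha a (wC hN hk c w) cf) (x0 ℓ Mh k c.1) (hx0 hpl) (hfit hN hMh1 hP4 hMha c ha hpl)).W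
        (eB (tC hN hk hMh1 hP4 c ha a (wC hN hk c w) cf) (x0 ℓ Mh k c.1))
        (onFun ((tC hN hk hMh1 hP4 c ha a (wC hN hk c w) cf).lapTS ∘ₗ (tC hN hk hMh1 hP4 c ha a (wC hN hk c w) cf).D.G))) *
      TB (vch Mh k (svec ℓ k c.1.1 c.1.2)) := by
  rw [LC, Gl_eq, conj_mul, mul_smul_comm, onFun_comp, ← Module.End.mul_eq_comp,
    transplant_mul_of_bij (W := (cB (tC hN hk hMh1 hP4 c ha a (wC hN hk c w) cf) (x0 ℓ Mh k c.1) (hx0 hpl) (hfit hN hMh1 hP4 hMha c ha hpl)).W)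
      (e := eB (tC hN hk hMh1 hP4 c ha a (wC hN hk c w) cf) (x0 ℓ Mh k c.1))
      (cB (tC hN hk hMh1 hP4 c ha a (wC hN hk c w) cf) (x0 ℓ Mh k c.1) (hx0 hpl) (hfit hN hMh1 hP4 hMha c ha hpl)).inj
      (cB (tC hN hk hMh1 hP4 c ha a (wC hN hk c w) cf) (x0 ℓ Mh k c.1) (hx0 hpl) (hfit hN hMh1 hP4 hMha c ha hpl)).surj]

include hMha in
/-- **`χ·LC = (L^{j₀}/c′)²•χ·LapV c′`** for every multiplier `χ` whose chart translate `τ_vχ` is supported on `1`-deep bonds of the window (`c′ ≠ 0`).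
[cite: Balaban1984PropagatorsII, (2.94) p.239 (rescaling), (2.19) p.226, p.238 (T_□); Balaban1984PropagatorsI, (1.110) p.35] -/
theorem mulOp_mul_LC (hpl : Placed ℓ k P' c.1) (w : BondIdx (domT hN D hk) → ℝ) {cf : ℝ} (hcf : cf ≠ 0)
    (χ : PBond (PV d ℓ m K hd hL) 0 → ℝ)
    (hχ : ∀ b, trV (vch Mh k (svec ℓ k c.1.1 c.1.2)) χ b ≠ 0 →
      b.src ∈ DeepS (tC hN hk hMh1 hP4 c ha a (wC hN hk c w) cf) (x0 ℓ Mh k c.1) 1) :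
    mulOp χ * LC hN hk hMh1 hP4 hMha c ha hpl w cf =
      ((((ℓ + 1 : ℕ) : ℝ)) ^ j0 hMh1 hP4 c / cf) ^ 2 • (mulOp χ * LapV cf) := by
  rw [LC, mulOp_eq_conj (vch Mh k (svec ℓ k c.1.1 c.1.2)) χ]
  set v := vch (ℓ := ℓ) (m := m) (K := K) (hd := hd) (hL := hL) Mh k (svec ℓ k c.1.1 c.1.2) with hv
  have e1 : TB (-v) * mulOp (trV v χ) * TB v *
      (TB (-v) * transplant (cB (tC hN hk hMh1 hP4 c ha a (wC hN hk c w) cf) (x0 ℓ Mh k c.1) (hx0 hpl) (hfit hN hMh1 hP4 hMha c ha hpl)).W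
        (eB (tC hN hk hMh1 hP4 c ha a (wC hN hk c w) cf) (x0 ℓ Mh k c.1)) (onFun (tC hN hk hMh1 hP4 c ha a (wC hN hk c w) cf).lapTS) * TB v) =
      TB (-v) * (mulOp (trV v χ) * transplant (cB (tC hN hk hMh1 hP4 c ha a (wC hN hk c w) cf) (x0 ℓ Mh k c.1) (hx0 hpl)
        (hfit hN hMh1 hP4 hMha c ha hpl)).W (eB (tC hN hk hMh1 hP4 c ha a (wC hN hk c w) cf) (x0 ℓ Mh k c.1))
        (onFun (tC hN hk hMh1 hP4 c ha a (wC hN hk c w) cf).lapTS)) * TB v := by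
    simp only [mul_assoc]
    rw [← mul_assoc (TB v) (TB (-v)), TB_mul_TB_neg, one_mul]
  rw [e1, mulOp_mul_transplant_lapTS _ _ _ _ hcf (trV v χ) hχ, tC_j, mul_smul_comm, smul_mul_assoc]
  congr 1
  simp only [mul_assoc]
  rw [← TB_mul_LapV]

/-- **`hLapGin` FOR THE CUBE: THE MEMBER INPUT (2.133)₄ = (1.110)₄, INPUT-LOCALISED, GLOBAL DECAY** (`L ≥ 5`): the leg `LC·G_□` (the transplant of
`ΔG_□`) has `InMajorant (geomT D) (blkV1 hN D) (LC·G_□) (Q^T_□) (C·(L^{j(y)}/c′)²·e^{−δ_G d_T})`, one `(δ_G, C)` for all cubes — p22's member majorant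
`ineq2133_LapG` through r03's band bridge `inDecay_window_V1`, EXACTLY as r03's `hEGin_cube`.  The prefactor is `(L^{j(y)}/c′)²` (the unit `s(□)⁻¹`; the
two powers `(c′/L^{j₀})²` of `mulOp_mul_LC` bring it to print's `1`). [cite: Balaban1984PropagatorsII, (2.133) p.247, Prop. 2.5 p.246, Prop. 2.6 (2.136) p.247 («|(ΔGJ)(x)| ≤ O(1)·1·…»); Balaban1984PropagatorsI, (1.110) p.35] -/
theorem hLapGin_cube (d ℓ : ℕ) (hd : 1 ≤ d + 1) (hL : Odd (ℓ + 1) ∧ 1 < ℓ + 1) {a₀ a₁ : ℝ} (ha₀ : 0 < a₀) (ha₁ : a₀ ≤ a₁) :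
    ∃ δG : ℝ, 0 < δG ∧ ∃ CG : ℝ, 0 ≤ CG ∧ ∀ (m K : ℕ) {Mh k R : ℕ} {P' : Fin (d + 1) → ℕ}
      (hN : ∀ μ, N0 ℓ Mh k P' μ = (PV d ℓ m K hd hL).sitesPerDir 0) (D : TDomains d ℓ Mh k P' R) (hk : k ≤ m + K)
      (hMh1 : 1 ≤ Mh) (hP4 : ∀ μ, 4 ≤ P' μ) {a : ℕ} (hMha : Mh = (ℓ + 1) ^ a) (_ : 2 ≤ Mh) (_ : 2 * (ℓ + 1) ^ 2 ≤ R) (_ : 4 ≤ ℓ)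
      (c : ↥(cubes D.toDomains)) (hpl : Placed ℓ k P' c.1) (w : BondIdx (domT hN D hk) → ℝ) (cf : ℝ),
      InMajorant (g := geomT D) (blkV1 hN D) (LC hN hk hMh1 hP4 hMha c ha₁ hpl w cf * Gl hN hk hMh1 hP4 hMha c ha₁ hpl w cf) (ST D hMh1 hP4 c)
        (fun y y' => CG * pref cf y * Real.exp (-(δG * (geomT D).dist y y'))) := by
  obtain ⟨δ, hδ, A, hA, hmem⟩ := ineq2133_LapG d (ℓ + 1) hd hL ha₀ ha₁
  refine ⟨δ / (((d : ℝ) + 1) * ((9 : ℕ) : ℝ)), by positivity,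
    (((ℓ + 1) ^ (d + 1) : ℕ) : ℝ) * (A * Real.exp (δ * (((d : ℝ) + 1) + ((d : ℝ) + 1)) / (((d : ℝ) + 1) * ((9 : ℕ) : ℝ)))), by positivity, ?_⟩
  intro m K Mh k R P' hN D hk hMh1 hP4 a hMha hMh hR2 hℓ c hpl w cf
  have hP : ∀ μ, 1 ≤ P' μ := one_le_of_four_le hP4
  have h1 := inDecay_window_V1 (t := tC hN hk hMh1 hP4 c ha₁ a (wC hN hk c w) cf) (x₀ := x0 ℓ Mh k c.1) (hx₀ := hx0 hpl)
    (hfit := hfit hN hMh1 hP4 hMha c ha₁ hpl) hN (D.chart (svec ℓ k c.1.1 c.1.2)) hA hδ.le (hmem _ 0 0) hMh1 hP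
    (hdiv_cube hN hk hMh1 hP4 c ha₁ (wC hN hk c w) cf) (hlev_full hN hk hMh1 hP4 hMha c ha₁ hR2 (wC hN hk c w) cf) (C := 9) (by norm_num)
    (SQ hMh1 hP4 c) (fun b _ hbS => hband_cube hN hk hMh1 hP4 hMha c ha₁ hℓ hMh hR2 (wC hN hk c w) cf b hbS)
  have h2 := inMajorant_smul_of_le_on (blkV1 hN (D.chart (svec ℓ k c.1.1 c.1.2))) h1 _
    (transplant_off hN hk hMh1 hP4 hMha c ha₁ hpl (wC hN hk c w) cf _) (inv_nonneg.2 (sc_nonneg hMh1 hP4 c cf))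
    (K' := fun y y' => (((ℓ + 1) ^ (d + 1) : ℕ) : ℝ) * (A * Real.exp (δ * (((d : ℝ) + 1) + ((d : ℝ) + 1)) / (((d : ℝ) + 1) * ((9 : ℕ) : ℝ)))) *
      pref cf y * Real.exp (-(δ / (((d : ℝ) + 1) * ((9 : ℕ) : ℝ)) * (geomT (D.chart (svec ℓ k c.1.1 c.1.2))).dist y y')))
    (fun a b => by have := pref_nonneg cf a; positivity)
    (fun b hb y _ => smul_kernel_le (sc_inv_le_pref hN hk hMh1 hP4 hMha c ha₁ hR2 hpl (wC hN hk c w) cf hb) (by positivity) (by positivity)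
      (Real.exp_nonneg _))
  have h3 := inMajorant_conj_chart hN D hMh1 hP (svec ℓ k c.1.1 c.1.2) h2
    (K' := fun y y' => (((ℓ + 1) ^ (d + 1) : ℕ) : ℝ) * (A * Real.exp (δ * (((d : ℝ) + 1) + ((d : ℝ) + 1)) / (((d : ℝ) + 1) * ((9 : ℕ) : ℝ)))) *
      pref cf y * Real.exp (-(δ / (((d : ℝ) + 1) * ((9 : ℕ) : ℝ)) * (geomT D).dist y y')))
    (fun a b => le_of_eq (kernel_blkMap D hMh1 hP (svec ℓ k c.1.1 c.1.2) (fun n => ((((ℓ + 1 : ℕ) : ℝ)) ^ n / cf) ^ 2) _ _ a b))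
  rw [LC_mul_Gl_eq]
  exact inMajorant_congr_set _ (mem_blkMap_image_SQ hMh1 hP4 c) h3

/-- **THE BLOCK OF `b` IS IN `□⁺` WHEN `h_□(b − e_ν) ≠ 0`** (`M_h ≥ 8`, `R ≥ 2L`, `P′ ≥ 5`).
[cite: Balaban1984PropagatorsII, p.235, p.239 (supports of h_□), bookkeeping] -/
theorem blkV1_mem_ST_of_hB_unshift_ne_zero (hM8 : 8 ≤ Mh) (hR : 2 * (ℓ + 1) ≤ R) (hP5 : ∀ μ, 5 ≤ P' μ) (ν : Fin (d + 1))
    {b : PBond (PV d ℓ m K hd hL) 0} (h : hB hN D c ⟨b.src.unshift ν, b.dir⟩ ≠ 0) : blkV1 hN D b ∈ ST D hMh1 hP4 c := by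
  rw [hB_apply] at h
  dsimp only at h
  rw [toBox_unshift hN] at h
  have h1 : ∀ i, 1 ≤ N0 ℓ Mh k P' i := one_le_of_mem (toBox hN b.src).2
  refine (mem_ST D hMh1 hP4 c _).2 (blkOf_mem_QT_of_near_hT D (one_le_ell hL) hM8 hR hP5 hP4 c h ?_)
  have e : (toBox hN b.src).1 - (tshift (N0 ℓ Mh k P') (-unitVec ν) (toBox hN b.src)).1 =
      (tshift (N0 ℓ Mh k P') (unitVec ν) (tshift (N0 ℓ Mh k P') (-unitVec ν) (toBox hN b.src))).1 -
        (tshift (N0 ℓ Mh k P') (-unitVec ν) (toBox hN b.src)).1 := by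
    rw [B6MultiLevelTorusOperator.tshift_tshift, neg_add_cancel, B6MultiLevelTorusOperator.tshift_zero]
  rw [e]
  exact torusSupNorm_tshift_unitVec_le h1 ν _

/-- **`|h_□(b − e_ν) − h_□(b)| ≤ C1F/(8S/5)`**, `S = M_h·L^{j(□)+1}` (p38's (1.118) first-step size `abs_hT_sub_le_near`).
[cite: Balaban1984PropagatorsII, p.247 / (2.92) p.239 line 1 (the size of ∂h_□; cf. [3] p.577 «|∂^ηh_j| ≤ O(M⁻¹)»)] -/
theorem abs_hB_unshift_sub_le (hMh : 2 ≤ Mh) (hR : 2 * (ℓ + 1) ≤ R) (hP5 : ∀ μ, 5 ≤ P' μ) (ν : Fin (d + 1)) (b : PBond (PV d ℓ m K hd hL) 0) :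
    |hB hN D c ⟨b.src.unshift ν, b.dir⟩ - hB hN D c b| ≤ C1F d ℓ / (8 / 5 * (bigSide ℓ Mh c.1.1 : ℝ)) := by
  rw [hB_apply, hB_apply]
  dsimp only
  rw [toBox_unshift hN]
  have h1 : ∀ i, 1 ≤ N0 ℓ Mh k P' i := one_le_of_mem (toBox hN b.src).2
  refine abs_hT_sub_le_near (one_le_ell hL) hMh hR hP5 c ?_
  have e : (toBox hN b.src).1 - (tshift (N0 ℓ Mh k P') (-unitVec ν) (toBox hN b.src)).1 =
      (tshift (N0 ℓ Mh k P') (unitVec ν) (tshift (N0 ℓ Mh k P') (-unitVec ν) (toBox hN b.src))).1 -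
        (tshift (N0 ℓ Mh k P') (-unitVec ν) (toBox hN b.src)).1 := by
    rw [B6MultiLevelTorusOperator.tshift_tshift, neg_add_cancel, B6MultiLevelTorusOperator.tshift_zero]
  rw [e]
  exact torusSupNorm_tshift_unitVec_le h1 ν _

/-- **`|Δh_□(b)| ≤ c′²·(d+1)·C2F/(8S/5)²`** (p38's (1.118) second-step size `abs_hT_second_diff_le`, summed over the `d + 1` directions).
[cite: Balaban1984PropagatorsII, p.247 / (2.92) p.239 line 1 («(Δh_□)(x)»; cf. [3] p.577 «|Δ^ηh_j| ≤ O(M⁻²)»)] -/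
theorem abs_LapV_hB_le (hMh : 2 ≤ Mh) (hR : 2 * (ℓ + 1) ≤ R) (hP5 : ∀ μ, 5 ≤ P' μ) (cf : ℝ) (b : PBond (PV d ℓ m K hd hL) 0) :
    |LapV cf (hB hN D c) b| ≤ cf ^ 2 * (((d : ℝ) + 1) * (C2F d ℓ / (8 / 5 * (bigSide ℓ Mh c.1.1 : ℝ)) ^ 2)) := by
  refine (abs_LapV_apply_le cf _ b).trans (mul_le_mul_of_nonneg_left ?_ (sq_nonneg cf))
  have hsum : ∑ _ν : Fin (PV d ℓ m K hd hL).d, C2F d ℓ / (8 / 5 * (bigSide ℓ Mh c.1.1 : ℝ)) ^ 2 =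
      ((d : ℝ) + 1) * (C2F d ℓ / (8 / 5 * (bigSide ℓ Mh c.1.1 : ℝ)) ^ 2) := by
    rw [Finset.sum_const, Finset.card_univ, nsmul_eq_mul]
    simp [PV]
  rw [← hsum]
  refine Finset.sum_le_sum fun ν _ => ?_
  rw [hB_apply, hB_apply, hB_apply]
  dsimp only
  rw [toBox_unshift hN, toBox_shift hN,
    show 2 * hT D c (toBox hN b.src) - hT D c (tshift (N0 ℓ Mh k P') (-unitVec ν) (toBox hN b.src)) -
        hT D c (tshift (N0 ℓ Mh k P') (unitVec ν) (toBox hN b.src)) =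
      -(hT D c (tshift (N0 ℓ Mh k P') (unitVec ν) (toBox hN b.src)) - 2 * hT D c (toBox hN b.src) +
        hT D c (tshift (N0 ℓ Mh k P') (-unitVec ν) (toBox hN b.src))) by ring, abs_neg]
  exact abs_hT_second_diff_le (one_le_ell hL) hMh hR hP5 c ν _

include hMha in
/-- the chart translate of `h_□` is `h^ch_□`, supported on `1`-deep bonds of the member's window (r03's `hch_deep`: margin `4L^{j₀+1} ≥ 1`).
[cite: Balaban1984PropagatorsII, p.238 (□ ⊂ □̃³), (2.36) p.229, bookkeeping] -/
theorem hB_deep (hM8 : 8 ≤ Mh) (hR2 : 2 * (ℓ + 1) ^ 2 ≤ R) (w : BondIdx (domT hN D hk) → ℝ) (cf : ℝ)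
    (b : PBond (PV d ℓ m K hd hL) 0) (hb : trV (vch Mh k (svec ℓ k c.1.1 c.1.2)) (hB hN D c) b ≠ 0) :
    b.src ∈ DeepS (tC hN hk hMh1 hP4 c ha a (wC hN hk c w) cf) (x0 ℓ Mh k c.1) 2 := by
  rw [trV_hB hN hMh1 hP4 c] at hb
  have hdeep := hch_deep hN hMh1 hP4 hMha c ha hM8 hR2 hb
  refine deepS_mono ?_ hdeep
  have : 1 ≤ (ℓ + 1) ^ (j0 hMh1 hP4 c + 1) := Nat.one_le_pow _ _ (Nat.succ_pos ℓ)
  omega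

include hMha in
/-- the chart translate of `∇_νh_□` is supported on `1`-deep bonds. [cite: Balaban1984PropagatorsII, p.238 (□ ⊂ □̃³), bookkeeping] -/
theorem DV_hB_deep (hM8 : 8 ≤ Mh) (hR2 : 2 * (ℓ + 1) ^ 2 ≤ R) (hpl : Placed ℓ k P' c.1) (w : BondIdx (domT hN D hk) → ℝ) (cf cf' : ℝ)
    (ν : Fin (d + 1)) (b : PBond (PV d ℓ m K hd hL) 0) (hb : trV (vch Mh k (svec ℓ k c.1.1 c.1.2)) (DV ν cf' (hB hN D c)) b ≠ 0) :
    b.src ∈ DeepS (tC hN hk hMh1 hP4 c ha a (wC hN hk c w) cf) (x0 ℓ Mh k c.1) 1 := by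
  by_cases h1 : trV (vch Mh k (svec ℓ k c.1.1 c.1.2)) (shB ν (hB hN D c)) b ≠ 0
  · exact shB_hB_deep hN hk hMh1 hP4 hMha c ha hM8 hR2 hpl w cf ν b h1
  · have h2 : trV (vch Mh k (svec ℓ k c.1.1 c.1.2)) (hB hN D c) b ≠ 0 := by
      intro h0; apply hb
      rw [trV_apply, DV_apply]
      rw [trV_apply, shB_apply] at h1
      rw [trV_apply] at h0
      rw [not_not.1 h1, h0]; ring
    exact deepS_mono (by norm_num) (hB_deep hN hk hMh1 hP4 hMha c ha hM8 hR2 w cf b h2)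

include hMha in
/-- the chart translate of `∇*_νh_□` is supported on `1`-deep bonds. [cite: Balaban1984PropagatorsII, p.238 (□ ⊂ □̃³), bookkeeping] -/
theorem DVa_hB_deep (hM8 : 8 ≤ Mh) (hR2 : 2 * (ℓ + 1) ^ 2 ≤ R) (hpl : Placed ℓ k P' c.1) (w : BondIdx (domT hN D hk) → ℝ) (cf cf' : ℝ)
    (ν : Fin (d + 1)) (b : PBond (PV d ℓ m K hd hL) 0) (hb : trV (vch Mh k (svec ℓ k c.1.1 c.1.2)) (DVa ν cf' (hB hN D c)) b ≠ 0) :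
    b.src ∈ DeepS (tC hN hk hMh1 hP4 c ha a (wC hN hk c w) cf) (x0 ℓ Mh k c.1) 1 := by
  by_cases h1 : trV (vch Mh k (svec ℓ k c.1.1 c.1.2)) (shBi ν (hB hN D c)) b ≠ 0
  · -- `h_□(b + v − e_ν) ≠ 0`: the point `b + v − e_ν` is `2`-deep, so `b + v` is `1`-deep
    rw [trV_shBi, shBi_apply] at h1
    have h3 := hB_deep hN hk hMh1 hP4 hMha c ha hM8 hR2 w cf ⟨b.src.unshift ν, b.dir⟩ h1
    have h4 := (shift_mem_deepS (t := tC hN hk hMh1 hP4 c ha a (wC hN hk c w) cf) (hfit hN hMh1 hP4 hMha c ha hpl) (r := 1) h3 ν).1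
    simpa [shift_unshift] using h4
  · have h2 : trV (vch Mh k (svec ℓ k c.1.1 c.1.2)) (hB hN D c) b ≠ 0 := by
      intro h0; apply hb
      rw [trV_apply, DVa_apply]
      rw [trV_apply, shBi_apply] at h1
      rw [trV_apply] at h0
      rw [not_not.1 h1, h0]; ring
    exact deepS_mono (by norm_num) (hB_deep hN hk hMh1 hP4 hMha c ha hM8 hR2 w cf b h2)

include hMha in
/-- **THE OPERATOR IDENTITY FOR THE FIRST LEG OF `ΔG`**:
`Δ(h_□G_□h_□) = (c′/L^{j₀})²•(h_□·(LC·G_□)·h_□) − Σ_ν[(c′/L^{j₀})•((∇_νh_□)·(E_(ν,+)G_□)·h_□) + (c′/L^{j₀})•((∇*_νh_□)·(E_(ν,−)G_□)·h_□)] + (Δh_□)·G_□·h_□`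
on the global torus. [cite: Balaban1984PropagatorsII, (2.141) p.247 (first leg), (2.92) p.239 (line 1), (2.94) p.239] -/
theorem LapV_sandwich_eq (hM8 : 8 ≤ Mh) (hR2 : 2 * (ℓ + 1) ^ 2 ≤ R) (hpl : Placed ℓ k P' c.1) (w : BondIdx (domT hN D hk) → ℝ) {cf : ℝ}
    (hcf : cf ≠ 0) :
    LapV cf * (mulOp (hB hN D c) * Gl hN hk hMh1 hP4 hMha c ha hpl w cf * mulOp (hB hN D c)) =
      (cf / (((ℓ + 1 : ℕ) : ℝ)) ^ j0 hMh1 hP4 c) ^ 2 •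
          (mulOp (hB hN D c) * (LC hN hk hMh1 hP4 hMha c ha hpl w cf * Gl hN hk hMh1 hP4 hMha c ha hpl w cf) * mulOp (hB hN D c)) -
        ∑ ν : Fin (d + 1),
          ((cf / (((ℓ + 1 : ℕ) : ℝ)) ^ j0 hMh1 hP4 c) •
              (mulOp (DV ν cf (hB hN D c)) * (EC hN hk hMh1 hP4 hMha c ha hpl w cf (ν, true) * Gl hN hk hMh1 hP4 hMha c ha hpl w cf) *
                mulOp (hB hN D c)) +
            (cf / (((ℓ + 1 : ℕ) : ℝ)) ^ j0 hMh1 hP4 c) •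
              (mulOp (DVa ν cf (hB hN D c)) * (EC hN hk hMh1 hP4 hMha c ha hpl w cf (ν, false) * Gl hN hk hMh1 hP4 hMha c ha hpl w cf) *
                mulOp (hB hN D c))) +
        mulOp (LapV cf (hB hN D c)) * Gl hN hk hMh1 hP4 hMha c ha hpl w cf * mulOp (hB hN D c) := by
  have hLj : ((((ℓ + 1 : ℕ) : ℝ)) ^ j0 hMh1 hP4 c) ≠ 0 := by positivity
  -- the three identifications on the deep supports
  have k0 := mulOp_mul_LC hN hk hMh1 hP4 hMha c ha hpl w hcf (hB hN D c)
    (fun b hb => deepS_mono (by norm_num) (hB_deep hN hk hMh1 hP4 hMha c ha hM8 hR2 w cf b hb))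
  have k1 : ∀ ν : Fin (d + 1), mulOp (DV ν cf (hB hN D c)) * EC hN hk hMh1 hP4 hMha c ha hpl w cf (ν, true) =
      ((((ℓ + 1 : ℕ) : ℝ)) ^ j0 hMh1 hP4 c / cf) • (mulOp (DV ν cf (hB hN D c)) * DV ν cf) := fun ν =>
    mulOp_mul_EC_true hN hk hMh1 hP4 hMha c ha hpl w hcf ν _ (fun b hb => DV_hB_deep hN hk hMh1 hP4 hMha c ha hM8 hR2 hpl w cf cf ν b hb)
  have k2 : ∀ ν : Fin (d + 1), mulOp (DVa ν cf (hB hN D c)) * EC hN hk hMh1 hP4 hMha c ha hpl w cf (ν, false) =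
      ((((ℓ + 1 : ℕ) : ℝ)) ^ j0 hMh1 hP4 c / cf) • (mulOp (DVa ν cf (hB hN D c)) * DVa ν cf) := fun ν =>
    mulOp_mul_EC_false hN hk hMh1 hP4 hMha c ha hpl w hcf ν _ (fun b hb => DVa_hB_deep hN hk hMh1 hP4 hMha c ha hM8 hR2 hpl w cf cf ν b hb)
  have hprod := LapV_mul_mulOp cf (hB hN D c)
  -- atoms
  generalize EC hN hk hMh1 hP4 hMha c ha hpl w cf = E at k1 k2 ⊢
  generalize LC hN hk hMh1 hP4 hMha c ha hpl w cf = Lc at k0 ⊢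
  generalize Gl hN hk hMh1 hP4 hMha c ha hpl w cf = G
  generalize mulOp (hB hN D c) = Hm at k0 hprod ⊢
  generalize mulOp (LapV cf (hB hN D c)) = Lh at hprod ⊢
  generalize (LapV (P := PV d ℓ m K hd hL) cf) = Lp at k0 hprod ⊢
  set q : ℝ := cf / (((ℓ + 1 : ℕ) : ℝ)) ^ j0 hMh1 hP4 c with hq
  -- invert the three identifications
  have hinv : ((((ℓ + 1 : ℕ) : ℝ)) ^ j0 hMh1 hP4 c / cf) * q = 1 := by
    rw [hq, div_mul_div_comm, mul_comm _ cf, div_self (mul_ne_zero hcf hLj)]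
  have k0' : Hm * Lp = q ^ 2 • (Hm * Lc) := by
    rw [k0, smul_smul, ← mul_pow, mul_comm q, hinv, one_pow, one_smul]
  have k1' : ∀ ν : Fin (d + 1), mulOp (DV ν cf (hB hN D c)) * DV ν cf = q • (mulOp (DV ν cf (hB hN D c)) * E (ν, true)) := fun ν => by
    rw [k1 ν, smul_smul, mul_comm q, hinv, one_smul]
  have k2' : ∀ ν : Fin (d + 1), mulOp (DVa ν cf (hB hN D c)) * DVa ν cf = q • (mulOp (DVa ν cf (hB hN D c)) * E (ν, false)) := fun ν => by
    rw [k2 ν, smul_smul, mul_comm q, hinv, one_smul]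
  calc Lp * (Hm * G * Hm) = (Lp * Hm) * G * Hm := by simp only [mul_assoc]
    _ = (Hm * Lp - ∑ ν : Fin (d + 1), (mulOp (DV ν cf (hB hN D c)) * DV ν cf + mulOp (DVa ν cf (hB hN D c)) * DVa ν cf) + Lh) * G * Hm := by
        rw [hprod]
    _ = (Hm * Lp) * G * Hm - (∑ ν : Fin (d + 1), (mulOp (DV ν cf (hB hN D c)) * DV ν cf + mulOp (DVa ν cf (hB hN D c)) * DVa ν cf)) * G * Hm +
          Lh * G * Hm := by
        rw [add_mul, add_mul, sub_mul, sub_mul]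
    _ = _ := by
        rw [k0', smul_mul_assoc, smul_mul_assoc, Finset.sum_mul, Finset.sum_mul]
        have hsum : ∑ ν : Fin (d + 1), (mulOp (DV ν cf (hB hN D c)) * DV ν cf + mulOp (DVa ν cf (hB hN D c)) * DVa ν cf) * G * Hm =
            ∑ ν : Fin (d + 1), (q • (mulOp (DV ν cf (hB hN D c)) * (E (ν, true) * G) * Hm) +
              q • (mulOp (DVa ν cf (hB hN D c)) * (E (ν, false) * G) * Hm)) := by
          refine Finset.sum_congr rfl fun ν _ => ?_
          rw [k1' ν, k2' ν, add_mul, add_mul, smul_mul_assoc, smul_mul_assoc, smul_mul_assoc, smul_mul_assoc]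
          simp only [mul_assoc]
        rw [hsum]
        simp only [mul_assoc]

end Cube

/-! ## §4  THE FIRST LEG OF (2.141) FOR `ΔG`, PER CUBE: `Δ(h_□G_□h_□)` has the majorant `1_{□⁺}(y)·C_Δ·e^{−ρ_Δ d_T}` (print's prefactor `1`) -/

section Leg

variable {d ℓ : ℕ} {hd : 1 ≤ d + 1} {hL : Odd (ℓ + 1) ∧ 1 < ℓ + 1} {m K : ℕ} {Mh k R : ℕ} {P' : Fin (d + 1) → ℕ}

/-- the three scale facts of `□⁺` against the window: `len(y) ≤ L²·L^{j₀}`, `L^{j₀} ≤ 8S/5`, `L^{j₀} > 0`, in the form used below: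
on `□⁺`, `(c′/L^{j₀})²·(L^{j(y)}/c′)² ≤ L⁴`. [cite: Balaban1984PropagatorsII, (2.94) p.239, (2.136) p.247, p.235, bookkeeping] -/
theorem sq_scale_le (hL : Odd (ℓ + 1) ∧ 1 < ℓ + 1) {D : TDomains d ℓ Mh k P' R} (hMh1 : 1 ≤ Mh) (hP4 : ∀ μ, 4 ≤ P' μ)
    (c : ↥(cubes D.toDomains)) (hR2 : 2 * (ℓ + 1) ^ 2 ≤ R) {cf : ℝ} (hcf : cf ≠ 0) {y : (geomT D).Site} (hy : y ∈ ST D hMh1 hP4 c) :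
    (cf / (((ℓ + 1 : ℕ) : ℝ)) ^ j0 hMh1 hP4 c) ^ 2 * pref cf y ≤ (((ℓ + 1 : ℕ) : ℝ)) ^ 4 := by
  have hR : 2 * (ℓ + 1) ≤ R := le_trans (by nlinarith : 2 * (ℓ + 1) ≤ 2 * (ℓ + 1) ^ 2) hR2
  have hlev : y.1.1 ≤ j0 hMh1 hP4 c + 2 := by
    have h1 := level_le_of_mem_QT hMh1 hP4 c hR ((mem_ST D hMh1 hP4 c y).1 hy)
    have h2 := (j0_le_level hMh1 hP4 c hL hR2).2
    omega
  have hL1 : (1 : ℝ) ≤ ((ℓ + 1 : ℕ) : ℝ) := by exact_mod_cast Nat.succ_pos ℓ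
  have hpow : (((ℓ + 1 : ℕ) : ℝ)) ^ (y.1.1 : ℕ) ≤ (((ℓ + 1 : ℕ) : ℝ)) ^ 2 * (((ℓ + 1 : ℕ) : ℝ)) ^ j0 hMh1 hP4 c := by
    rw [← pow_add]; exact pow_le_pow_right₀ hL1 (by omega)
  have hj0 : (0 : ℝ) < (((ℓ + 1 : ℕ) : ℝ)) ^ j0 hMh1 hP4 c := by positivity
  unfold pref
  rw [← mul_pow, div_mul_div_comm, mul_comm cf, mul_div_mul_right _ _ hcf, show ((((ℓ + 1 : ℕ) : ℝ)) ^ 4) = ((((ℓ + 1 : ℕ) : ℝ)) ^ 2) ^ 2 by ring]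
  exact pow_le_pow_left₀ (by positivity) ((div_le_iff₀ hj0).2 hpow) 2

/-- on `□⁺`: `|c′|/L^{j₀}·(L²·X·(L^{j(y)}·|c′|⁻¹)) ≤ L⁴·X` for `X ≥ 0` (one more power than gen 30's `pref_scale_le`).
[cite: Balaban1984PropagatorsII, (2.94) p.239, (2.136) p.247, p.235, bookkeeping] -/
theorem lin_scale_le (hL : Odd (ℓ + 1) ∧ 1 < ℓ + 1) {D : TDomains d ℓ Mh k P' R} (hMh1 : 1 ≤ Mh) (hP4 : ∀ μ, 4 ≤ P' μ)
    (c : ↥(cubes D.toDomains)) (hR2 : 2 * (ℓ + 1) ^ 2 ≤ R) {cf : ℝ} (hcf : cf ≠ 0) {y : (geomT D).Site} (hy : y ∈ ST D hMh1 hP4 c) {X : ℝ}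
    (hX : 0 ≤ X) :
    |cf| / (((ℓ + 1 : ℕ) : ℝ)) ^ j0 hMh1 hP4 c * ((((ℓ + 1 : ℕ) : ℝ)) ^ 2 * X * ((geomT D).len y * |cf|⁻¹)) ≤ (((ℓ + 1 : ℕ) : ℝ)) ^ 4 * X := by
  have hR : 2 * (ℓ + 1) ≤ R := le_trans (by nlinarith : 2 * (ℓ + 1) ≤ 2 * (ℓ + 1) ^ 2) hR2
  have hlev : y.1.1 ≤ j0 hMh1 hP4 c + 2 := by
    have h1 := level_le_of_mem_QT hMh1 hP4 c hR ((mem_ST D hMh1 hP4 c y).1 hy)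
    have h2 := (j0_le_level hMh1 hP4 c hL hR2).2
    omega
  have hL1 : (1 : ℝ) ≤ ((ℓ + 1 : ℕ) : ℝ) := by exact_mod_cast Nat.succ_pos ℓ
  have hpow : (((ℓ + 1 : ℕ) : ℝ)) ^ (y.1.1 : ℕ) ≤ (((ℓ + 1 : ℕ) : ℝ)) ^ 2 * (((ℓ + 1 : ℕ) : ℝ)) ^ j0 hMh1 hP4 c := by
    rw [← pow_add]; exact pow_le_pow_right₀ hL1 (by omega)
  have hj0 : (0 : ℝ) < (((ℓ + 1 : ℕ) : ℝ)) ^ j0 hMh1 hP4 c := by positivity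
  have elen : (geomT D).len y = (((ℓ + 1 : ℕ) : ℝ)) ^ (y.1.1 : ℕ) := by rw [geomT_len, mul_one]; push_cast; ring
  have hc : 0 < |cf| := abs_pos.2 hcf
  rw [elen, show |cf| / (((ℓ + 1 : ℕ) : ℝ)) ^ j0 hMh1 hP4 c * ((((ℓ + 1 : ℕ) : ℝ)) ^ 2 * X * ((((ℓ + 1 : ℕ) : ℝ)) ^ (y.1.1 : ℕ) * |cf|⁻¹)) =
    (((ℓ + 1 : ℕ) : ℝ)) ^ 2 * X * ((((ℓ + 1 : ℕ) : ℝ)) ^ (y.1.1 : ℕ) / (((ℓ + 1 : ℕ) : ℝ)) ^ j0 hMh1 hP4 c) by field_simp]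
  have hrat : (((ℓ + 1 : ℕ) : ℝ)) ^ (y.1.1 : ℕ) / (((ℓ + 1 : ℕ) : ℝ)) ^ j0 hMh1 hP4 c ≤ (((ℓ + 1 : ℕ) : ℝ)) ^ 2 := (div_le_iff₀ hj0).2 hpow
  calc (((ℓ + 1 : ℕ) : ℝ)) ^ 2 * X * ((((ℓ + 1 : ℕ) : ℝ)) ^ (y.1.1 : ℕ) / (((ℓ + 1 : ℕ) : ℝ)) ^ j0 hMh1 hP4 c)
      ≤ (((ℓ + 1 : ℕ) : ℝ)) ^ 2 * X * (((ℓ + 1 : ℕ) : ℝ)) ^ 2 := mul_le_mul_of_nonneg_left hrat (by positivity)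
    _ = (((ℓ + 1 : ℕ) : ℝ)) ^ 4 * X := by ring

/-- on `□⁺`: `c′²·((d+1)·C2F/(8S/5)²)·(L^{j(y)}/c′)² ≤ L⁴·(d+1)·C2F` (`L^{j₀} ≤ 8S/5`, `j(y) ≤ j₀ + 2`).
[cite: Balaban1984PropagatorsII, p.247 (size of Δh_□), (2.94) p.239, bookkeeping] -/
theorem lap_scale_le (hL : Odd (ℓ + 1) ∧ 1 < ℓ + 1) {D : TDomains d ℓ Mh k P' R} (hMh1 : 1 ≤ Mh) (hP4 : ∀ μ, 4 ≤ P' μ)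
    (c : ↥(cubes D.toDomains)) (hR2 : 2 * (ℓ + 1) ^ 2 ≤ R) {cf : ℝ} (hcf : cf ≠ 0) {y : (geomT D).Site} (hy : y ∈ ST D hMh1 hP4 c) :
    cf ^ 2 * (((d : ℝ) + 1) * (C2F d ℓ / (8 / 5 * (bigSide ℓ Mh c.1.1 : ℝ)) ^ 2)) * pref cf y ≤
      (((ℓ + 1 : ℕ) : ℝ)) ^ 4 * (((d : ℝ) + 1) * C2F d ℓ) := by
  have hR : 2 * (ℓ + 1) ≤ R := le_trans (by nlinarith : 2 * (ℓ + 1) ≤ 2 * (ℓ + 1) ^ 2) hR2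
  have hC := C2F_nonneg d ℓ
  have hlev : y.1.1 ≤ j0 hMh1 hP4 c + 2 := by
    have h1 := level_le_of_mem_QT hMh1 hP4 c hR ((mem_ST D hMh1 hP4 c y).1 hy)
    have h2 := (j0_le_level hMh1 hP4 c hL hR2).2
    omega
  have hL1 : (1 : ℝ) ≤ ((ℓ + 1 : ℕ) : ℝ) := by exact_mod_cast Nat.succ_pos ℓ
  have hpow : (((ℓ + 1 : ℕ) : ℝ)) ^ (y.1.1 : ℕ) ≤ (((ℓ + 1 : ℕ) : ℝ)) ^ 2 * (((ℓ + 1 : ℕ) : ℝ)) ^ j0 hMh1 hP4 c := by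
    rw [← pow_add]; exact pow_le_pow_right₀ hL1 (by omega)
  have hj0 : (0 : ℝ) < (((ℓ + 1 : ℕ) : ℝ)) ^ j0 hMh1 hP4 c := by positivity
  have hS : (((ℓ + 1 : ℕ) : ℝ)) ^ j0 hMh1 hP4 c ≤ 8 / 5 * (bigSide ℓ Mh c.1.1 : ℝ) := by
    have hj := (j0_le_level hMh1 hP4 c hL hR2).1
    unfold bigSide; push_cast
    have hL1' : (1 : ℝ) ≤ (ℓ : ℝ) + 1 := by linarith [Nat.cast_nonneg (α := ℝ) ℓ]
    have hM : (1 : ℝ) ≤ Mh := by exact_mod_cast hMh1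
    have h1 : ((ℓ : ℝ) + 1) ^ j0 hMh1 hP4 c ≤ ((ℓ : ℝ) + 1) ^ (c.1.1 + 1) := pow_le_pow_right₀ hL1' (by omega)
    have h2 : ((ℓ : ℝ) + 1) ^ (c.1.1 + 1) ≤ (Mh : ℝ) * ((ℓ : ℝ) + 1) ^ (c.1.1 + 1) := le_mul_of_one_le_left (by positivity) hM
    nlinarith [pow_nonneg (by positivity : (0:ℝ) ≤ (ℓ : ℝ) + 1) (c.1.1 + 1)]
  have hS0 : (0 : ℝ) < 8 / 5 * (bigSide ℓ Mh c.1.1 : ℝ) := lt_of_lt_of_le hj0 hS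
  -- `cf²·(C/S²)·(Λ/cf)² = C·(Λ/S)²`
  unfold pref
  have e : cf ^ 2 * (((d : ℝ) + 1) * (C2F d ℓ / (8 / 5 * (bigSide ℓ Mh c.1.1 : ℝ)) ^ 2)) * ((((ℓ + 1 : ℕ) : ℝ)) ^ (y.1.1 : ℕ) / cf) ^ 2 =
      (((d : ℝ) + 1) * C2F d ℓ) * ((((ℓ + 1 : ℕ) : ℝ)) ^ (y.1.1 : ℕ) / (8 / 5 * (bigSide ℓ Mh c.1.1 : ℝ))) ^ 2 := by
    field_simp
  rw [e, mul_comm ((((ℓ + 1 : ℕ) : ℝ)) ^ 4)]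
  refine mul_le_mul_of_nonneg_left ?_ (by positivity)
  have hrat : (((ℓ + 1 : ℕ) : ℝ)) ^ (y.1.1 : ℕ) / (8 / 5 * (bigSide ℓ Mh c.1.1 : ℝ)) ≤ (((ℓ + 1 : ℕ) : ℝ)) ^ 2 :=
    (div_le_iff₀ hS0).2 (hpow.trans (mul_le_mul_of_nonneg_left hS (by positivity)))
  rw [show ((((ℓ + 1 : ℕ) : ℝ)) ^ 4) = ((((ℓ + 1 : ℕ) : ℝ)) ^ 2) ^ 2 by ring]
  exact pow_le_pow_left₀ (by positivity) hrat 2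

/-- majorants of a difference add (the `−` of the Leibniz rule). [folklore] -/
private theorem hasMajorant_sub' {g : B6.Geometry} {X : Type} (blk : X → g.Site) {T₁ T₂ : Module.End ℝ (X → ℝ)} {K₁ K₂ : g.Site → g.Site → ℝ}
    (h₁ : HasMajorant blk T₁ K₁) (h₂ : HasMajorant blk T₂ K₂) : HasMajorant blk (T₁ - T₂) (fun a b => K₁ a b + K₂ a b) := by
  intro y' μ B hμ x
  have e : (T₁ - T₂) μ x = T₁ μ x - T₂ μ x := rfl
  rw [e, add_mul]
  exact (abs_sub _ _).trans (add_le_add (h₁ y' μ B hμ x) (h₂ y' μ B hμ x))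

/-- the kernel template: a sandwiched leg with output indicator, weakened to the common shape `1·(B·e^{−ρd})` at a located output block.
[cite: Balaban1984PropagatorsII, (2.136) p.247, bookkeeping] -/
private theorem kernel_template {c i' s C P E E' B : ℝ} (hi' : 0 ≤ i') (hi'1 : i' ≤ 1) (hs : 0 ≤ s) (hC : 0 ≤ C)
    (hP : 0 ≤ P) (hE' : 0 ≤ E') (hEE' : E ≤ E') (hB : |c| * s * C * P ≤ B) :
    |c| * ((1 : ℝ) * i' * (s * (C * P * E))) ≤ (1 : ℝ) * (B * E') := by
  have h0 : 0 ≤ |c| := abs_nonneg _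
  have hE : s * (C * P * E) ≤ s * (C * P * E') := mul_le_mul_of_nonneg_left (mul_le_mul_of_nonneg_left hEE' (mul_nonneg hC hP)) hs
  have hCPE' : 0 ≤ s * (C * P * E') := by positivity
  calc |c| * (1 * i' * (s * (C * P * E))) ≤ |c| * (1 * i' * (s * (C * P * E'))) := by gcongr
    _ ≤ |c| * (1 * 1 * (s * (C * P * E'))) := by gcongr
    _ = (|c| * s * C * P) * E' := by ring
    _ ≤ B * E' := mul_le_mul_of_nonneg_right hB hE'
    _ = 1 * (B * E') := (one_mul _).symm

open Classical in
/-- **THE FIRST LEG OF (2.141) FOR THE ENTRY `|(ΔGJ)(x)|`, PER CUBE, FOR THE GENUINE MEMBER** (`L ≥ 5`): there are `ρ_Δ > 0`, `C_Δ ≥ 0` (on `d, L`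
and the weight band `[a₀, a₁]` only) such that on every admissible V1 torus (`M_h = Lᵃ ≥ 8`, `R ≥ 2L²`, `P′ ≥ 5`, cube placed), for every `c′ ≠ 0`,
weights `w` and cube `□`:
`HasMajorant (geomT D) (blkV1 hN D) (Δ·(h_□G_□h_□)) (1_{□⁺}(y)·C_Δ·e^{−ρ_Δ d_T(y,y′)})` — print's `O(1)·1·e^{−δd}` for the first leg of the fourth column,
from (2.133)₁,₂,₄ for the member (r03's `hGin_cube`/`hEGin_cube`, `hLapGin_cube` above) and the sizes of `∂h_□`, `∂*h_□`, `Δh_□`.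
[cite: Balaban1984PropagatorsII, Prop. 2.6 (2.136) p.247 («|(ΔGJ)(x)| ≤ O(1)·1·…»), (2.141) p.247, (2.133) p.247, (2.92) p.239 line 1] -/
theorem hLapG0_cube (d ℓ : ℕ) (hd : 1 ≤ d + 1) (hL : Odd (ℓ + 1) ∧ 1 < ℓ + 1) {a₀ a₁ : ℝ} (ha₀ : 0 < a₀) (ha₁ : a₀ ≤ a₁) :
    ∃ ρD : ℝ, 0 < ρD ∧ ∃ CD : ℝ, 0 ≤ CD ∧ ∀ (m K : ℕ) {Mh k R : ℕ} {P' : Fin (d + 1) → ℕ}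
      (hN : ∀ μ, N0 ℓ Mh k P' μ = (PV d ℓ m K hd hL).sitesPerDir 0) (D : TDomains d ℓ Mh k P' R) (hk : k ≤ m + K)
      (hMh1 : 1 ≤ Mh) (hP4 : ∀ μ, 4 ≤ P' μ) {a : ℕ} (hMha : Mh = (ℓ + 1) ^ a) (_ : 8 ≤ Mh) (_ : 2 * (ℓ + 1) ^ 2 ≤ R) (_ : ∀ μ, 5 ≤ P' μ)
      (_ : 4 ≤ ℓ) (c : ↥(cubes D.toDomains)) (hpl : Placed ℓ k P' c.1) (w : BondIdx (domT hN D hk) → ℝ) {cf : ℝ} (_ : cf ≠ 0),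
      HasMajorant (g := geomT D) (blkV1 hN D)
        (LapV cf * (mulOp (hB hN D c) * Gl hN hk hMh1 hP4 hMha c ha₁ hpl w cf * mulOp (hB hN D c)))
        (fun y y' => ind (ST D hMh1 hP4 c) y * (CD * Real.exp (-(ρD * (geomT D).dist y y')))) := by
  obtain ⟨ρG, hρG, CG, hCG, hGin⟩ := hGin_cube d ℓ hd hL ha₀ ha₁
  obtain ⟨ρE, hρE, CE, hCE, hEGin⟩ := hEGin_cube d ℓ hd hL ha₀ ha₁
  obtain ⟨ρL, hρL, CL, hCL, hLGin⟩ := hLapGin_cube d ℓ hd hL ha₀ ha₁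
  refine ⟨min ρG (min ρE ρL), lt_min hρG (lt_min hρE hρL),
    (((ℓ + 1 : ℕ) : ℝ)) ^ 4 * CL + (((d : ℝ) + 1) * ((((ℓ + 1 : ℕ) : ℝ)) ^ 4 * C1F d ℓ * CE + (((ℓ + 1 : ℕ) : ℝ)) ^ 4 * C1F d ℓ * CE)) +
      (((ℓ + 1 : ℕ) : ℝ)) ^ 4 * (((d : ℝ) + 1) * C2F d ℓ) * CG, by
    have := C1F_nonneg d ℓ; have := C2F_nonneg d ℓ; positivity, ?_⟩
  intro m K Mh k R P' hN D hk hMh1 hP4 a hMha hM8 hR2 hP5 hℓ c hpl w cf hcf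
  have hMh : 2 ≤ Mh := le_trans (by norm_num) hM8
  have hR : 2 * (ℓ + 1) ≤ R := le_trans (by nlinarith : 2 * (ℓ + 1) ≤ 2 * (ℓ + 1) ^ 2) hR2
  have hP : ∀ μ, 1 ≤ P' μ := one_le_of_four_le hP4
  have hdnn : ∀ y y' : (geomT D).Site, 0 ≤ (geomT D).dist y y' := fun _ _ => Nat.cast_nonneg _
  have hC1 := C1F_nonneg d ℓ
  have hC2 := C2F_nonneg d ℓ
  set S := ST D hMh1 hP4 c with hS
  set ρ := min ρG (min ρE ρL) with hρ
  have hρG' : ρ ≤ ρG := min_le_left _ _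
  have hρE' : ρ ≤ ρE := (min_le_right _ _).trans (min_le_left _ _)
  have hρL' : ρ ≤ ρL := (min_le_right _ _).trans (min_le_right _ _)
  have hexp : ∀ {ρX : ℝ}, ρ ≤ ρX → ∀ y y' : (geomT D).Site, Real.exp (-(ρX * (geomT D).dist y y')) ≤ Real.exp (-(ρ * (geomT D).dist y y')) :=
    fun h y y' => Real.exp_le_exp.mpr (neg_le_neg (mul_le_mul_of_nonneg_right h (hdnn y y')))
  -- supports of `h_□` and of its shifts / differences (blockwise within `□⁺`)
  have hsupp0 : ∀ b, hB hN D c b ≠ 0 → blkV1 hN D b ∈ S := fun b hb => (mem_ST D hMh1 hP4 c _).2 (blkV1_mem_QT_of_hB_ne_zero hN D hMh hR hP4 c hb)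
  have hsupp1 : ∀ ν b, DV ν cf (hB hN D c) b ≠ 0 → blkV1 hN D b ∈ S := fun ν b hb => by
    by_cases h1 : hB hN D c ⟨b.src.shift ν, b.dir⟩ ≠ 0
    · exact blkV1_mem_ST_of_hB_shift_ne_zero hN hMh1 hP4 c hM8 hR hP5 ν h1
    · have h2 : hB hN D c b ≠ 0 := by
        intro h0; apply hb; rw [DV_apply, not_not.1 h1, h0]; ring
      exact hsupp0 b h2
  have hsupp2 : ∀ ν b, DVa ν cf (hB hN D c) b ≠ 0 → blkV1 hN D b ∈ S := fun ν b hb => by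
    by_cases h1 : hB hN D c ⟨b.src.unshift ν, b.dir⟩ ≠ 0
    · exact blkV1_mem_ST_of_hB_unshift_ne_zero hN hMh1 hP4 c hM8 hR hP5 ν h1
    · have h2 : hB hN D c b ≠ 0 := by
        intro h0; apply hb; rw [DVa_apply, not_not.1 h1, h0]; ring
      exact hsupp0 b h2
  have hsupp3 : ∀ b, LapV cf (hB hN D c) b ≠ 0 → blkV1 hN D b ∈ S := fun b hb => by
    by_contra hnot
    apply hb
    rw [LapV_apply]
    have h0 : hB hN D c b = 0 := by by_contra h; exact hnot (hsupp0 b h)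
    have h1 : ∀ ν, hB hN D c ⟨b.src.shift ν, b.dir⟩ = 0 := fun ν => by
      by_contra h; exact hnot (blkV1_mem_ST_of_hB_shift_ne_zero hN hMh1 hP4 c hM8 hR hP5 ν h)
    have h2 : ∀ ν, hB hN D c ⟨b.src.unshift ν, b.dir⟩ = 0 := fun ν => by
      by_contra h; exact hnot (blkV1_mem_ST_of_hB_unshift_ne_zero hN hMh1 hP4 c hM8 hR hP5 ν h)
    rw [Finset.sum_eq_zero (fun ν _ => by rw [h0, h1 ν, h2 ν]; ring), mul_zero]
  -- the four sandwiched legs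
  have hT0 := hasMajorant_sandwich_in (g := geomT D) (blkV1 hN D) (S := S) (s := 1) (f := hB hN D c) (h := hB hN D c)
    (K := fun y y' => CL * pref cf y * Real.exp (-(ρL * (geomT D).dist y y')))
    (fun y y' => by have := pref_nonneg cf y; positivity) zero_le_one hsupp0 (fun b => abs_hB_le_one hN D hMh1 hP c b) hsupp0
    (fun b => abs_hB_le_one hN D hMh1 hP c b) (hLGin m K hN D hk hMh1 hP4 hMha hMh hR2 hℓ c hpl w cf)
  have hT1 : ∀ ν : Fin (d + 1), HasMajorant (g := geomT D) (blkV1 hN D)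
      (mulOp (DV ν cf (hB hN D c)) * (EC hN hk hMh1 hP4 hMha c ha₁ hpl w cf (ν, true) * Gl hN hk hMh1 hP4 hMha c ha₁ hpl w cf) * mulOp (hB hN D c))
      (fun a b => ind S a * ind S b * (|cf| * (C1F d ℓ / (8 / 5 * (bigSide ℓ Mh c.1.1 : ℝ))) *
        (CE * pref cf a * Real.exp (-(ρE * (geomT D).dist a b))))) := fun ν =>
    hasMajorant_sandwich_in (g := geomT D) (blkV1 hN D) (S := S) (s := |cf| * (C1F d ℓ / (8 / 5 * (bigSide ℓ Mh c.1.1 : ℝ))))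
      (f := DV ν cf (hB hN D c)) (h := hB hN D c) (K := fun y y' => CE * pref cf y * Real.exp (-(ρE * (geomT D).dist y y')))
      (fun y y' => by have := pref_nonneg cf y; positivity) (by positivity) (hsupp1 ν)
      (fun b => by rw [abs_DV_apply]; exact mul_le_mul_of_nonneg_left (abs_hB_shift_sub_le hN c hMh hR hP5 ν b) (abs_nonneg _))
      hsupp0 (fun b => abs_hB_le_one hN D hMh1 hP c b) (hEGin m K hN D hk hMh1 hP4 hMha hMh hR2 hℓ c hpl w cf (ν, true))
  have hT2 : ∀ ν : Fin (d + 1), HasMajorant (g := geomT D) (blkV1 hN D)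
      (mulOp (DVa ν cf (hB hN D c)) * (EC hN hk hMh1 hP4 hMha c ha₁ hpl w cf (ν, false) * Gl hN hk hMh1 hP4 hMha c ha₁ hpl w cf) * mulOp (hB hN D c))
      (fun a b => ind S a * ind S b * (|cf| * (C1F d ℓ / (8 / 5 * (bigSide ℓ Mh c.1.1 : ℝ))) *
        (CE * pref cf a * Real.exp (-(ρE * (geomT D).dist a b))))) := fun ν =>
    hasMajorant_sandwich_in (g := geomT D) (blkV1 hN D) (S := S) (s := |cf| * (C1F d ℓ / (8 / 5 * (bigSide ℓ Mh c.1.1 : ℝ))))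
      (f := DVa ν cf (hB hN D c)) (h := hB hN D c) (K := fun y y' => CE * pref cf y * Real.exp (-(ρE * (geomT D).dist y y')))
      (fun y y' => by have := pref_nonneg cf y; positivity) (by positivity) (hsupp2 ν)
      (fun b => by rw [abs_DVa_apply]; exact mul_le_mul_of_nonneg_left (abs_hB_unshift_sub_le hN c hMh hR hP5 ν b) (abs_nonneg _))
      hsupp0 (fun b => abs_hB_le_one hN D hMh1 hP c b) (hEGin m K hN D hk hMh1 hP4 hMha hMh hR2 hℓ c hpl w cf (ν, false))
  have hT3 := hasMajorant_sandwich_in (g := geomT D) (blkV1 hN D) (S := S)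
    (s := cf ^ 2 * (((d : ℝ) + 1) * (C2F d ℓ / (8 / 5 * (bigSide ℓ Mh c.1.1 : ℝ)) ^ 2)))
    (f := LapV cf (hB hN D c)) (h := hB hN D c) (K := fun y y' => CG * pref cf y * Real.exp (-(ρG * (geomT D).dist y y')))
    (fun y y' => by have := pref_nonneg cf y; positivity) (by positivity) hsupp3 (fun b => abs_LapV_hB_le hN c hMh hR hP5 cf b)
    hsupp0 (fun b => abs_hB_le_one hN D hMh1 hP c b) (hGin m K hN D hk hMh1 hP4 hMha hMh hR2 hℓ c hpl w cf)
  -- each leg weakened to the common shape `1_S(y)·(B·e^{−ρd})`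
  have hq : |cf / (((ℓ + 1 : ℕ) : ℝ)) ^ j0 hMh1 hP4 c| = |cf| / (((ℓ + 1 : ℕ) : ℝ)) ^ j0 hMh1 hP4 c := by
    rw [abs_div, abs_of_pos (by positivity : (0 : ℝ) < (((ℓ + 1 : ℕ) : ℝ)) ^ j0 hMh1 hP4 c)]
  have hK0 := hasMajorant_mono (g := geomT D) (blkV1 hN D) (hasMajorant_smul (g := geomT D) (blkV1 hN D) hT0 ((cf / (((ℓ + 1 : ℕ) : ℝ)) ^ j0 hMh1 hP4 c) ^ 2))
    (K' := fun y y' => ind S y * ((((ℓ + 1 : ℕ) : ℝ)) ^ 4 * CL * Real.exp (-(ρ * (geomT D).dist y y')))) fun y y' => by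
      by_cases hy : y ∈ S
      · rw [ind_of_mem hy]
        refine kernel_template (ind_nonneg _ _) (ind_le_one _ _) zero_le_one hCL (pref_nonneg cf y) (Real.exp_nonneg _) (hexp hρL' y y') ?_
        rw [abs_pow, hq, show (|cf| / (((ℓ + 1 : ℕ) : ℝ)) ^ j0 hMh1 hP4 c) ^ 2 = (cf / (((ℓ + 1 : ℕ) : ℝ)) ^ j0 hMh1 hP4 c) ^ 2 by rw [div_pow, div_pow, sq_abs]]
        calc (cf / (((ℓ + 1 : ℕ) : ℝ)) ^ j0 hMh1 hP4 c) ^ 2 * 1 * CL * pref cf y = CL * ((cf / (((ℓ + 1 : ℕ) : ℝ)) ^ j0 hMh1 hP4 c) ^ 2 * pref cf y) := by ring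
          _ ≤ CL * (((ℓ + 1 : ℕ) : ℝ)) ^ 4 := mul_le_mul_of_nonneg_left (sq_scale_le hL hMh1 hP4 c hR2 hcf hy) hCL
          _ = (((ℓ + 1 : ℕ) : ℝ)) ^ 4 * CL := mul_comm _ _
      · rw [ind_of_not_mem hy]; simp
  have hK1 : ∀ ν : Fin (d + 1), HasMajorant (g := geomT D) (blkV1 hN D)
      ((cf / (((ℓ + 1 : ℕ) : ℝ)) ^ j0 hMh1 hP4 c) •
        (mulOp (DV ν cf (hB hN D c)) * (EC hN hk hMh1 hP4 hMha c ha₁ hpl w cf (ν, true) * Gl hN hk hMh1 hP4 hMha c ha₁ hpl w cf) *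
          mulOp (hB hN D c)))
      (fun y y' => ind S y * ((((ℓ + 1 : ℕ) : ℝ)) ^ 4 * C1F d ℓ * CE * Real.exp (-(ρ * (geomT D).dist y y')))) := fun ν =>
    hasMajorant_mono (g := geomT D) (blkV1 hN D) (hasMajorant_smul (g := geomT D) (blkV1 hN D) (hT1 ν) (cf / (((ℓ + 1 : ℕ) : ℝ)) ^ j0 hMh1 hP4 c))
      fun y y' => by
        by_cases hy : y ∈ S
        · rw [ind_of_mem hy]
          refine kernel_template (ind_nonneg _ _) (ind_le_one _ _) (by positivity) hCE (pref_nonneg cf y) (Real.exp_nonneg _) (hexp hρE' y y') ?_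
          rw [hq]
          calc |cf| / (((ℓ + 1 : ℕ) : ℝ)) ^ j0 hMh1 hP4 c * (|cf| * (C1F d ℓ / (8 / 5 * (bigSide ℓ Mh c.1.1 : ℝ)))) * CE * pref cf y
              = CE * (|cf| / (((ℓ + 1 : ℕ) : ℝ)) ^ j0 hMh1 hP4 c * (|cf| * (C1F d ℓ / (8 / 5 * (bigSide ℓ Mh c.1.1 : ℝ))) * pref cf y)) := by ring
            _ ≤ CE * (|cf| / (((ℓ + 1 : ℕ) : ℝ)) ^ j0 hMh1 hP4 c * ((((ℓ + 1 : ℕ) : ℝ)) ^ 2 * C1F d ℓ * ((geomT D).len y * |cf|⁻¹))) :=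
                mul_le_mul_of_nonneg_left (mul_le_mul_of_nonneg_left (lip_scale_le hL hMh1 hP4 c hR2 hcf hy) (by positivity)) hCE
            _ ≤ CE * ((((ℓ + 1 : ℕ) : ℝ)) ^ 4 * C1F d ℓ) := mul_le_mul_of_nonneg_left (lin_scale_le hL hMh1 hP4 c hR2 hcf hy hC1) hCE
            _ = (((ℓ + 1 : ℕ) : ℝ)) ^ 4 * C1F d ℓ * CE := by ring
        · rw [ind_of_not_mem hy]; simp
  have hK2 : ∀ ν : Fin (d + 1), HasMajorant (g := geomT D) (blkV1 hN D)
      ((cf / (((ℓ + 1 : ℕ) : ℝ)) ^ j0 hMh1 hP4 c) •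
        (mulOp (DVa ν cf (hB hN D c)) * (EC hN hk hMh1 hP4 hMha c ha₁ hpl w cf (ν, false) * Gl hN hk hMh1 hP4 hMha c ha₁ hpl w cf) *
          mulOp (hB hN D c)))
      (fun y y' => ind S y * ((((ℓ + 1 : ℕ) : ℝ)) ^ 4 * C1F d ℓ * CE * Real.exp (-(ρ * (geomT D).dist y y')))) := fun ν =>
    hasMajorant_mono (g := geomT D) (blkV1 hN D) (hasMajorant_smul (g := geomT D) (blkV1 hN D) (hT2 ν) (cf / (((ℓ + 1 : ℕ) : ℝ)) ^ j0 hMh1 hP4 c))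
      fun y y' => by
        by_cases hy : y ∈ S
        · rw [ind_of_mem hy]
          refine kernel_template (ind_nonneg _ _) (ind_le_one _ _) (by positivity) hCE (pref_nonneg cf y) (Real.exp_nonneg _) (hexp hρE' y y') ?_
          rw [hq]
          calc |cf| / (((ℓ + 1 : ℕ) : ℝ)) ^ j0 hMh1 hP4 c * (|cf| * (C1F d ℓ / (8 / 5 * (bigSide ℓ Mh c.1.1 : ℝ)))) * CE * pref cf y
              = CE * (|cf| / (((ℓ + 1 : ℕ) : ℝ)) ^ j0 hMh1 hP4 c * (|cf| * (C1F d ℓ / (8 / 5 * (bigSide ℓ Mh c.1.1 : ℝ))) * pref cf y)) := by ring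
            _ ≤ CE * (|cf| / (((ℓ + 1 : ℕ) : ℝ)) ^ j0 hMh1 hP4 c * ((((ℓ + 1 : ℕ) : ℝ)) ^ 2 * C1F d ℓ * ((geomT D).len y * |cf|⁻¹))) :=
                mul_le_mul_of_nonneg_left (mul_le_mul_of_nonneg_left (lip_scale_le hL hMh1 hP4 c hR2 hcf hy) (by positivity)) hCE
            _ ≤ CE * ((((ℓ + 1 : ℕ) : ℝ)) ^ 4 * C1F d ℓ) := mul_le_mul_of_nonneg_left (lin_scale_le hL hMh1 hP4 c hR2 hcf hy hC1) hCE
            _ = (((ℓ + 1 : ℕ) : ℝ)) ^ 4 * C1F d ℓ * CE := by ring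
        · rw [ind_of_not_mem hy]; simp
  have hK3 := hasMajorant_mono (g := geomT D) (blkV1 hN D) hT3
    (K' := fun y y' => ind S y * ((((ℓ + 1 : ℕ) : ℝ)) ^ 4 * (((d : ℝ) + 1) * C2F d ℓ) * CG * Real.exp (-(ρ * (geomT D).dist y y')))) fun y y' => by
      by_cases hy : y ∈ S
      · rw [ind_of_mem hy]
        have h := kernel_template (c := 1) (ind_nonneg S y') (ind_le_one S y') (by positivity : (0 : ℝ) ≤
            cf ^ 2 * (((d : ℝ) + 1) * (C2F d ℓ / (8 / 5 * (bigSide ℓ Mh c.1.1 : ℝ)) ^ 2))) hCG (pref_nonneg cf y) (Real.exp_nonneg _)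
          (hexp hρG' y y') (B := (((ℓ + 1 : ℕ) : ℝ)) ^ 4 * (((d : ℝ) + 1) * C2F d ℓ) * CG) ?_
        · rwa [abs_one, one_mul] at h
        · rw [abs_one, one_mul]
          calc cf ^ 2 * (((d : ℝ) + 1) * (C2F d ℓ / (8 / 5 * (bigSide ℓ Mh c.1.1 : ℝ)) ^ 2)) * CG * pref cf y
              = CG * (cf ^ 2 * (((d : ℝ) + 1) * (C2F d ℓ / (8 / 5 * (bigSide ℓ Mh c.1.1 : ℝ)) ^ 2)) * pref cf y) := by ring
            _ ≤ CG * ((((ℓ + 1 : ℕ) : ℝ)) ^ 4 * (((d : ℝ) + 1) * C2F d ℓ)) := mul_le_mul_of_nonneg_left (lap_scale_le hL hMh1 hP4 c hR2 hcf hy) hCG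
            _ = (((ℓ + 1 : ℕ) : ℝ)) ^ 4 * (((d : ℝ) + 1) * C2F d ℓ) * CG := by ring
      · rw [ind_of_not_mem hy]; simp
  -- the sum over the directions and the total
  have hKsum := hasMajorant_finsetSum (g := geomT D) (blkV1 hN D) (Finset.univ : Finset (Fin (d + 1))) _ _
    (fun ν _ => hasMajorant_add (g := geomT D) (blkV1 hN D) (hK1 ν) (hK2 ν))
  rw [LapV_sandwich_eq hN hk hMh1 hP4 hMha c ha₁ hM8 hR2 hpl w hcf]
  refine hasMajorant_mono (g := geomT D) (blkV1 hN D) (hasMajorant_add _ (hasMajorant_sub' _ hK0 hKsum) hK3) fun y y' => le_of_eq ?_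
  rw [Finset.sum_const, Finset.card_univ, Fintype.card_fin, nsmul_eq_mul]
  push_cast
  ring

end Leg

end Literature.MathematicalPhysics.QuantumFieldTheory.Balaban1983to89.B6LapLegKLevelV1
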